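import Literature.AlgebraicGeometry.Motives.HodgeThetaSubalgebraSymplecticRankTen
import HarnessLib

/-!
# The `Θ`-subalgebra theorem in rank eight: `𝔤_ℂ = 𝔰𝔭₈` unless `𝔤_ℂ` is in the plus-line (Mumford)
# position (Moonen–Zarhin 1999 Thm. (0.1)(3), §2 (2.5)(1): «if `g = 4` and `End⁰(X) = ℚ` then either
# `Hg(X) = Sp(V,φ) ≅ Sp_{8,ℚ}`, or `Hg(X)` is a `ℚ`-form of an almost direct product of three copies of `SL₂`»)

Family `hodge`, layer `Literature/AlgebraicGeometry/Motives` (abstract polarizable `ℚ`-Hodge structures; no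
geometry). Research context: cell `pub-hodge-ring2` (HONEST FRAMING: research route conditional on HC_CM; not a
corollary; Q11.4-sentence-2 already refuted in dim ≥ 3), Literature lane (lit gen 72), programme R49 = the row
«type I(1), `End⁰ = ℚ`» of the Moonen–Zarhin 1995 residual of `Summit.HodgeConjecture.Ring2.RowFourTypeIIOverQ`.
UNCONDITIONAL Hodge–Lie linear algebra; theorems only, no definition, no named fact (D-0026), no `sorry`.

THE PRINTED THEOREM. B. Moonen, Yu. Zarhin, *Hodge classes on abelian varieties of low dimension*, Math. Ann.
315 (1999) [held `paper:arxiv-math_9901113`], Thm. (0.1)(3) (p0001 L112–118): «Suppose we are in case (d)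
[`X` simple of dimension `4` with `End⁰(X) = ℚ`]. Then the Hodge ring `B•(X)` is generated by divisor classes …
Either `Hg(X) = Sp(V,φ)`, in which case `B•(Xⁿ) = D•(Xⁿ)` for all `n`, or `Hg(X)` is isogenous to a `ℚ`-form of
`SL₂ × SL₂ × SL₂`, in which case there are exceptional Hodge classes in `B²(X²)`»; §2 (2.5)(1) (p0005
L142–148): «if `g = 4` and `End⁰(X) = ℚ` then either `Hg(X) = Sp(V,φ) ≅ Sp_{8,ℚ}`, or `Hg(X)` is a `ℚ`-form of an
almost direct product of three copies of `SL₂`. (See [MZ95].)»; D. Mumford, Math. Ann. 181 (1969) §4 (the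
examples). The printed proofs go through the classification of the pairs (`Hg_ℂ`, `V_ℂ`) by minuscule weights
(Moonen–Zarhin 1995, §§2–5). THIS FILE gives a classification-free proof of the complex–Hermitian core, in the
format of the tree's rank-ten theorem `SymplecticThetaTen.dichotomy` (lit gen 67): for `dim V = 8` and
`End_Hdg(V) = ℚ`, EITHER `𝔤_ℂ ∋` every `ψ_ℂ`-skew operator (`Hg = Sp₈`), OR `𝔤_ℂ` is in the PLUS-LINE position
(raising line `ℂB₀`, lowering line `ℂB̄₀`, `B₀B̄₀ = μ₀ ≠ 0` on `V^{1,0}` — the complexified shape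
`𝔰𝔩₂ ⊗ 1 ⊕ 1 ⊗ 𝔨` on `ℂ² ⊗ ℂ⁴` of Mumford's examples, which in rank `8` is NOT excluded: `4 ∣ 8`, cf.
`four_dvd_finrank_of_twin`).

THE ARGUMENT (new in rank eight). As in rank ten, for a raising `B ∈ 𝔤_ℂ` the Levi operator `L_B = BB̄|_P`
(`P = V^{1,0}`, `dim P = 4`) is self-adjoint for the definite pairing `ψ_ℂ(x, conj y)`, hence diagonalizable
with real spectrum and spectral projectors in the Levi line algebra `𝔩 = {Z|_P : Z ∈ 𝔤_ℂ, Z P ⊆ P}`. A simple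
eigenvalue gives a rank-one idempotent in `𝔩`, hence `𝔩 = End(P)` (`SymplecticThetaSix.eq_top_of_rankOne_idempotent`)
and `𝔤_ℂ = 𝔰𝔭` (`SymplecticThetaTen.mem_spanC_of_skew_of_levi`); a single eigenvalue is the scalar case. The
new case is the pattern `(2,2)`: eigenvalues `a ≠ b` with two-dimensional eigenspaces `P_a`, `P_b`, say `a ≠ 0`.
* SPLITTING (§3): the involution `Θ' = E_a − E_b ∈ 𝔩` has a degree-`0` lift `Z₀ ∈ 𝔤_ℂ` with
  `Z₀(conj u) = −conj(Θ' u)` (`ψ`-duality and the `s`-orthogonality of `P_a ⊥ P_b`); then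
  `B₁ := ½B + ¼[Z₀, B] ∈ 𝔤_ℂ` is raising with `B₁(conj u) = B(conj E_a u)`, so `B₁B̄₁|_P = a E_a`.
* PENCIL (§4): for a degree-`0` `Z' ∈ 𝔤_ℂ` commuting with `Z₀`, `[Z', B₁]` is raising, kills `conj P_b` and
  maps `conj P_a` into `P_a`; if `[Z', B₁] ∉ ℂ B₁` then some `B' = [Z', B₁] − t B₁ ≠ 0` kills a non-zero vector of
  `conj P_a` (an eigenvector of the LINEAR map `w ↦ B(conj([Z',B₁] (conj w)))` on `P_a`), so `B'B̄'|_P` has rank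
  `≤ 1` and is non-zero: a simple eigenvalue — `𝔩 = End(P)` (§2).
* RIGIDITY (§5): if `[Z', B₁] ∈ ℂ B₁` for ALL such `Z'`, then every element of `𝔩` commuting with `Θ'` is, on
  `P_a`, a scalar plus an operator skew for the non-degenerate SYMMETRIC bilinear form `β(u, v) = ψ_ℂ(B̄₁ u, v)`;
  an isotropic vector `v₀ ∈ P_a` of `β` (`dim P_a = 2`) is then a common eigenvector, and
  `ℂ v₀ ⊕ 𝔩₋ v₀` is a proper non-zero `𝔩`-stable subspace of `P` — contradicting the irreducibility of `P`
  under `𝔩` (`SymplecticThetaSix.levi_irreducible`, from `End_Hdg = ℚ`).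
Hence (§6) **`SymplecticThetaEight.levi_eq_top_or_scalar`** (`dim V^{1,0} = 4`) and
**`SymplecticThetaEight.dichotomy`** (`dim V = 8`), with the same conclusions as the rank-ten theorems.

## References

* [MoonenZarhin1999LowDim] B. Moonen, Yu. Zarhin, Math. Ann. 315 (1999), Thm. (0.1)(3); §2 (2.3), (2.5)(1)
  [corpus: paper:arxiv-math_9901113 p0001 L112–118, p0005 L142–148].
* [MoonenZarhin1995Duke] B. Moonen, Yu. Zarhin, *Hodge classes and Tate classes on simple abelian fourfolds*,
  Duke Math. J. 77 (1995), §2 and the main theorem (type I(1)) [acq-04933 cite-only].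
* [Mumford1969NoteShimura] D. Mumford, *A note of Shimura's paper …*, Math. Ann. 181 (1969), §4.
* [Deligne1982HodgeCycles] P. Deligne, *Hodge cycles on abelian varieties*, LNM 900 (1982), I §3 (Prop. 3.4, 3.6).
* [HoffmanKunze1971LinearAlgebra] K. Hoffman, R. Kunze, *Linear Algebra* (1971), §6.7 Thm. 11, §8.5, §10.2–10.3.
* [GoodmanWallachGTM255] R. Goodman, N. R. Wallach, GTM 255 (2009), §2.1.2 (`𝔰𝔭` in block form), §4.1.1.
* [Gordon1997] B. B. Gordon, *A survey of the Hodge conjecture for abelian varieties*, §6 (proof of Thm. 6.3.3).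
-/

noncomputable section

open scoped TensorProduct
open Polynomial

namespace Literature.AlgebraicGeometry.Motives

namespace HodgeStructure

universe u

/-! ### §1 Degree-zero operators are determined by their restriction to `V^{1,0}`; the conjugate of a
degree-zero operator -/

section DegreeZero

variable {V : Type u} [AddCommGroup V] [Module ℚ V] {n : ℤ}

/-- **A `ψ_ℂ`-skew operator preserving `Q = V^{0,1}` and vanishing on `P = V^{1,0}` vanishes** (weight one:
`ψ_ℂ(Q, Q) = 0` and `ψ_ℂ` is non-degenerate, every vector being `p + q`). [cite: GoodmanWallachGTM255, §2.1.2]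
[cite: Deligne1982HodgeCycles, I §3 (proof of Prop. 3.4)] -/
theorem SymplecticThetaEight.eq_zero_of_skew_of_apply_piece_eq_zero [Module.Finite ℚ V] (H : HodgeStructure V n)
    (hn : n = 1) (heff : H.IsEffective) (ψ : H.Polarization) {Θ : Module.End ℂ (ℂ ⊗[ℚ] V)}
    (hΘ : ∀ p, ∀ x ∈ H.piece p (n - p), Θ x = ((2 * p - n : ℤ) : ℂ) • x) {X : Module.End ℂ (ℂ ⊗[ℚ] V)}
    (hXskew : ∀ x y, ψ.form.baseChange ℂ (X x) y + ψ.form.baseChange ℂ x (X y) = 0)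
    (hXQ : ∀ q ∈ H.piece 0 1, X q ∈ H.piece 0 1) (hXP : ∀ p ∈ H.piece 1 0, X p = 0) : X = 0 := by
  subst hn
  obtain ⟨hPmem, hQmem, -, -, -⟩ := UnitaryTheta.theta_facts H rfl heff hΘ
  set ω := ψ.form.baseChange ℂ with hω
  have hωnd : ω.Nondegenerate := ψ.nondegenerate_baseChange
  have hPQv : ∀ v : ℂ ⊗[ℚ] V, (2 : ℂ)⁻¹ • (v + Θ v) + (2 : ℂ)⁻¹ • (v - Θ v) = v := fun v => by module
  have hQQ : ∀ q ∈ H.piece 0 1, ∀ q' ∈ H.piece 0 1, ω q q' = 0 := fun q hq q' hq' =>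
    ψ.form_piece_piece (p := 0) (p' := 0) (by norm_num) (by simpa using hq) (by simpa using hq')
  have hXq : ∀ q ∈ H.piece 0 1, X q = 0 := by
    intro q hq
    refine hωnd.1 _ fun y => ?_
    rw [← hPQv y, map_add]
    have h1 : ω (X q) ((2 : ℂ)⁻¹ • (y + Θ y)) = 0 := by
      have h := hXskew q ((2 : ℂ)⁻¹ • (y + Θ y))
      rw [hXP _ (hPmem y), map_zero, add_zero] at h
      exact h
    rw [h1, hQQ _ (hXQ q hq) _ (hQmem y), add_zero]
  refine LinearMap.ext fun v => ?_
  rw [← hPQv v, map_add, hXP _ (hPmem v), hXq _ (hQmem v), add_zero, LinearMap.zero_apply]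

end DegreeZero

/-! ### §2 A non-zero raising operator whose Levi operator has rank `≤ 1` forces `𝔩 = End(V^{1,0})` -/

section RankOne

variable {V : Type u} [AddCommGroup V] [Module ℚ V] {n : ℤ}

set_option maxHeartbeats 1600000 in
/-- **A raising `B ≠ 0` in `𝔤_ℂ` whose Levi operator `BB̄|_{V^{1,0}}` has rank `≤ 1` makes the Levi line
algebra everything** (any rank). `BB̄|_P` is non-zero (second Hodge–Riemann relation:
`ψ_ℂ(BB̄p, conj p) = −ψ_ℂ(B̄p, conj B̄p) ≠ 0` once `B̄p ≠ 0`), self-adjoint for `ψ_ℂ(x, conj y)`, hence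
diagonalizable (`SymplecticThetaTen.iSup_eigenspace_eq_top_of_selfAdjoint`) with spectral projectors
`E_c = p_c(BB̄) ∈ 𝔩` (`SymplecticThetaTen.aeval_mem_levi`); a non-zero eigenvalue `c` has its eigenspace
inside the range, a line: `E_c` is a rank-one idempotent of the irreducible `𝔩 ∋ 1`
(`SymplecticThetaSix.levi_irreducible`), so `𝔩 = End(V^{1,0})` (`SymplecticThetaSix.eq_top_of_rankOne_idempotent`).
[cite: MoonenZarhin1999LowDim, §2 (2.3) and (2.5)(1)] [cite: HoffmanKunze1971LinearAlgebra, §6.7 Thm. 11]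
[cite: Deligne1982HodgeCycles, I §3 Prop. 3.4] -/
theorem SymplecticThetaEight.levi_eq_top_of_rankOne [Module.Finite ℚ V] (H : HodgeStructure V n) (hn : n = 1)
    (heff : H.IsEffective) (ψ : H.Polarization) (hE : ∀ a ∈ H.endAlg, ∃ x : ℚ, a = x • 1)
    (𝔤 : Submodule ℚ (Module.End ℚ V)) (hbr : ∀ X ∈ 𝔤, ∀ X' ∈ 𝔤, X * X' - X' * X ∈ 𝔤)
    {Θ : Module.End ℂ (ℂ ⊗[ℚ] V)} (hΘ : ∀ p, ∀ x ∈ H.piece p (n - p), Θ x = ((2 * p - n : ℤ) : ℂ) • x)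
    (hΘ𝔤 : Θ ∈ spanC 𝔤) (hskew : ∀ X ∈ 𝔤, ∀ v w, ψ.form (X v) w + ψ.form v (X w) = 0)
    {B C : Module.End ℂ (ℂ ⊗[ℚ] V)} (hB𝔤 : B ∈ spanC 𝔤) (hB0 : B ≠ 0)
    (hBP : ∀ p ∈ H.piece 1 0, B p = 0) (hBim : ∀ v, B v ∈ H.piece 1 0) (hC : ∀ v, C v = conj (B (conj v)))
    (hrk : ∃ u ∈ H.piece 1 0, ∀ p ∈ H.piece 1 0, ∃ r : ℂ, B (C p) = r • u) :
    ∀ A : Module.End ℂ ↥(H.piece 1 0), ∃ Z ∈ spanC 𝔤, ∀ p : ↥(H.piece 1 0),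
      ((A p : ↥(H.piece 1 0)) : ℂ ⊗[ℚ] V) = Z p := by
  classical
  have haeval := SymplecticThetaTen.aeval_mem_levi H hn heff 𝔤 hbr hΘ hΘ𝔤 hB𝔤 hBP hBim hC
  have hirr : ∀ U : Submodule ℂ (ℂ ⊗[ℚ] V), (∀ Z ∈ spanC 𝔤, ∀ u ∈ U, Z u ∈ U) → U = ⊥ ∨ U = ⊤ :=
    fun U hU => SymplecticTheta.eq_bot_or_top_of_stable H hn heff ψ hE 𝔤 hΘ hΘ𝔤 hskew
      fun X hX u hu => hU _ (baseChange_mem_spanC hX) u hu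
  subst hn
  obtain ⟨hPmem, hQmem, hΘ10, hΘ01, hΘΘ⟩ := UnitaryTheta.theta_facts H rfl heff hΘ
  set P := H.piece 1 0 with hPdef
  set Q := H.piece 0 1 with hQdef
  set M := ℂ ⊗[ℚ] V
  set ω := ψ.form.baseChange ℂ with hω
  have hPQ : ∀ x ∈ P, conj x ∈ Q := fun x hx => conj_mem_piece H hx
  have hQP : ∀ x ∈ Q, conj x ∈ P := fun x hx => conj_mem_piece H hx
  have h𝔊br : ∀ Z ∈ spanC 𝔤, ∀ Z' ∈ spanC 𝔤, Z * Z' - Z' * Z ∈ spanC 𝔤 := fun Z hZ Z' hZ' =>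
    commutator_mem_spanC hbr hZ hZ'
  have hBskew : ∀ x y, ω (B x) y + ω x (B y) = 0 := fun x y =>
    ThetaSubalgebra.formBaseChange_add_eq_zero_of_mem_spanC ψ hskew hB𝔤 x y
  obtain ⟨hCQ, hCim, hcC, hcB⟩ := SymplecticThetaTen.conjOp_raise hPQ hQP hBP hBim hC
  -- the Levi line algebra `𝔩 ⊆ End(P)`
  let 𝔩 : Submodule ℂ (Module.End ℂ ↥P) :=
    { carrier := {A | ∃ Z ∈ spanC 𝔤, ∀ p : ↥P, ((A p : ↥P) : M) = Z p}
      zero_mem' := ⟨0, Submodule.zero_mem _, fun p => by simp⟩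
      add_mem' := by
        rintro A A' ⟨Z, hZ, hAZ⟩ ⟨Z', hZ', hAZ'⟩
        exact ⟨Z + Z', Submodule.add_mem _ hZ hZ', fun p => by
          rw [LinearMap.add_apply, Submodule.coe_add, hAZ, hAZ', LinearMap.add_apply]⟩
      smul_mem' := by
        rintro c A ⟨Z, hZ, hAZ⟩
        exact ⟨c • Z, Submodule.smul_mem _ _ hZ, fun p => by
          rw [LinearMap.smul_apply, Submodule.coe_smul, hAZ, LinearMap.smul_apply]⟩ }
  have hmem𝔩 : ∀ A, A ∈ 𝔩 ↔ ∃ Z ∈ spanC 𝔤, ∀ p : ↥P, ((A p : ↥P) : M) = Z p := fun A => Iff.rfl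
  have h𝔩br : ∀ A ∈ 𝔩, ∀ A' ∈ 𝔩, A * A' - A' * A ∈ 𝔩 := by
    intro A hA A' hA'
    obtain ⟨Z, hZ, hAZ⟩ := (hmem𝔩 A).1 hA
    obtain ⟨Z', hZ', hAZ'⟩ := (hmem𝔩 A').1 hA'
    refine (hmem𝔩 _).2 ⟨Z * Z' - Z' * Z, h𝔊br _ hZ _ hZ', fun p => ?_⟩
    rw [LinearMap.sub_apply, Submodule.coe_sub, Module.End.mul_apply, Module.End.mul_apply, hAZ, hAZ', hAZ',
      hAZ, LinearMap.sub_apply, Module.End.mul_apply, Module.End.mul_apply]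
  have h𝔩1 : (1 : Module.End ℂ ↥P) ∈ 𝔩 :=
    (hmem𝔩 _).2 ⟨Θ, hΘ𝔤, fun p => by rw [Module.End.one_apply, hΘ10 p p.2]⟩
  have h𝔩irr : ∀ U : Submodule ℂ ↥P, (∀ A ∈ 𝔩, ∀ u ∈ U, A u ∈ U) → U = ⊥ ∨ U = ⊤ := by
    intro U hU
    refine SymplecticThetaSix.levi_irreducible (spanC 𝔤) h𝔊br hΘ𝔤 hΘΘ hΘ10 hΘ01 hPmem hQmem hirr U
      fun Z hZ hZP u hu => ?_
    exact hU _ ((hmem𝔩 _).2 ⟨Z, hZ, fun p => rfl⟩) u hu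
  -- `A = B B̄|_P` and its polynomials
  have hBCP : ∀ x ∈ P, (B * C) x ∈ P := fun x _ => hBim _
  set A : Module.End ℂ ↥P := (B * C).restrict hBCP with hAdef
  have hAapply : ∀ p : ↥P, ((A p : ↥P) : M) = B (C p) := fun p => rfl
  have hA𝔩 : ∀ f : ℂ[X], aeval A f ∈ 𝔩 := by
    intro f
    obtain ⟨Z, hZ, hZf⟩ := haeval f
    exact (hmem𝔩 _).2 ⟨Z, hZ, fun p => by rw [UnitaryThetaCore.aeval_restrict_coe hBCP f p, hZf p p.2]⟩
  -- the definite pairing `s(x, y) = ψ_ℂ(x, conj y)` on `P`, for which `A` is self-adjoint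
  let s : ↥P → ↥P → ℂ := fun x y => ω (x : M) (conj (y : M))
  have hs : ∀ x y : ↥P, s x y = ω (x : M) (conj (y : M)) := fun x y => rfl
  have hsadd₁ : ∀ x y z : ↥P, s (x + y) z = s x z + s y z := fun x y z => by
    rw [hs, hs, hs, Submodule.coe_add, map_add, LinearMap.add_apply]
  have hssmul₁ : ∀ (c : ℂ) (x z : ↥P), s (c • x) z = c * s x z := fun c x z => by
    rw [hs, hs, Submodule.coe_smul, map_smul, LinearMap.smul_apply, smul_eq_mul]
  have hsadd₂ : ∀ x y z : ↥P, s x (y + z) = s x y + s x z := fun x y z => by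
    rw [hs, hs, hs, Submodule.coe_add, map_add, map_add]
  have hssmul₂ : ∀ (c : ℂ) (x y : ↥P), s x (c • y) = starRingEnd ℂ c * s x y := fun c x y => by
    rw [hs, hs, Submodule.coe_smul, conj_smul, map_smul, smul_eq_mul]
  have hsdef : ∀ x : ↥P, s x x = 0 → x = 0 := by
    intro x hx
    by_contra hx0
    have hx0' : (x : M) ≠ 0 := fun h => hx0 (Subtype.ext h)
    exact ψ.form_conj_ne_zero (p := 1) (q := 0) (by norm_num) x.2 hx0' hx
  have hAsa : ∀ x y : ↥P, s (A x) y = s x (A y) := fun x y => by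
    rw [hs, hs, hAapply, hAapply]
    exact (SymplecticThetaTen.form_mul_conjOp_conj ψ.form hC hBskew (x : M) (y : M)).1
  obtain ⟨-, -, htop⟩ := SymplecticThetaTen.iSup_eigenspace_eq_top_of_selfAdjoint s hsadd₁ hssmul₁ hsadd₂ hssmul₂
    hsdef A hAsa
  -- the spectral resolution of `A`
  have hdiag := (Literature.LinearAlgebra.exists_basis_toMatrix_eq_diagonal_iff_iSup_eigenspace_eq_top A).2 htop
  obtain ⟨E, hElag, hAsum, hEsum, hEorth, hEidem, hErange, hEne⟩ :=
    Literature.LinearAlgebra.exists_resolution_of_diagonalizable A hdiag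
  set S := A.finite_hasEigenvalue.toFinset with hSdef
  have hE𝔩 : ∀ c, E c ∈ 𝔩 := fun c => by rw [hElag c]; exact hA𝔩 _
  have hEapply_mem : ∀ c ∈ S, ∀ x : ↥P, E c x ∈ A.eigenspace c := fun c hc x => by
    rw [← hErange c hc]; exact LinearMap.mem_range_self _ _
  -- `A ≠ 0`: `B ≠ 0` gives `p ∈ P` with `B̄ p ≠ 0`, and `ψ_ℂ(B B̄ p, conj p) = −ψ_ℂ(B̄ p, conj B̄ p) ≠ 0`
  have hA0 : A ≠ 0 := by
    intro hA0
    apply hB0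
    refine LinearMap.ext fun v => ?_
    rw [LinearMap.zero_apply]
    have hPQv : (2 : ℂ)⁻¹ • (v + Θ v) + (2 : ℂ)⁻¹ • (v - Θ v) = v := by module
    rw [← hPQv, map_add, hBP _ (hPmem v), zero_add]
    set q := (2 : ℂ)⁻¹ • (v - Θ v) with hq
    have hqQ : q ∈ Q := hQmem v
    -- `B q = conj (C (conj q))` with `conj q ∈ P`
    have hBq : B q = conj (C (conj q)) := by rw [hcC, conj_conj]
    by_contra hBq0
    have hCp0 : C (conj q) ≠ 0 := fun h => hBq0 (by rw [hBq, h, map_zero])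
    have hp : conj q ∈ P := hQP q hqQ
    have h2 := (SymplecticThetaTen.form_mul_conjOp_conj ψ.form hC hBskew (conj q) (conj q)).2
    have hBC0 : B (C (conj q)) = 0 := by
      have h := congrArg (fun T : Module.End ℂ ↥P => ((T ⟨conj q, hp⟩ : ↥P) : M)) hA0
      simpa only [hAapply, LinearMap.zero_apply, Submodule.coe_zero] using h
    rw [hBC0, map_zero, LinearMap.zero_apply, eq_comm, neg_eq_zero] at h2
    exact ψ.form_conj_ne_zero (p := 0) (q := 1) (by norm_num) (hCim _) hCp0 h2
  -- a non-zero eigenvalue `c ∈ S`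
  obtain ⟨c, hc, hc0⟩ : ∃ c ∈ S, c ≠ 0 := by
    by_contra hnone
    push Not at hnone
    apply hA0
    rw [hAsum]
    exact Finset.sum_eq_zero fun c hc => by rw [hnone c hc, zero_smul]
  -- its eigenspace is a line: inside `ℂ u`
  obtain ⟨u, huP, hu⟩ := hrk
  set u' : ↥P := ⟨u, huP⟩ with hu'
  have hline_le : ∀ w ∈ A.eigenspace c, ∃ r : ℂ, w = r • u' := by
    intro w hw
    have hw' := Module.End.mem_eigenspace_iff.1 hw
    obtain ⟨r, hr⟩ := hu (w : M) w.2
    refine ⟨c⁻¹ * r, ?_⟩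
    apply Subtype.ext
    have h1 : ((A w : ↥P) : M) = c • (w : M) := by rw [hw', Submodule.coe_smul]
    rw [hAapply, hr] at h1
    rw [Submodule.coe_smul, hu', mul_smul, h1, smul_smul, inv_mul_cancel₀ hc0, one_smul]
  have hcE : A.HasEigenvalue c := (Set.Finite.mem_toFinset _).1 hc
  obtain ⟨w₀, hw₀⟩ := hcE.exists_hasEigenvector
  have hw₀mem : w₀ ∈ A.eigenspace c := hw₀.1
  have hw₀0 : w₀ ≠ 0 := hw₀.2
  obtain ⟨r₀, hr₀⟩ := hline_le w₀ hw₀mem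
  have hr₀0 : r₀ ≠ 0 := fun h => hw₀0 (by rw [hr₀, h, zero_smul])
  have hu'mem : u' ∈ A.eigenspace c := by
    have h : u' = r₀⁻¹ • w₀ := by rw [hr₀, smul_smul, inv_mul_cancel₀ hr₀0, one_smul]
    rw [h]; exact Submodule.smul_mem _ _ hw₀mem
  have hu'0 : u' ≠ 0 := fun h => hw₀0 (by rw [hr₀, h, smul_zero])
  -- the rank-one idempotent `E_c = φ ⊗ u'`
  have hπu : E c u' = u' := by
    obtain ⟨y, hy⟩ : u' ∈ LinearMap.range (E c) := by rw [hErange c hc]; exact hu'mem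
    rw [← hy, ← Module.End.mul_apply, hEidem c hc]
  obtain ⟨ℓ, hℓ⟩ := Module.Projective.exists_dual_eq_one ℂ hu'0
  set φ : Module.Dual ℂ ↥P := ℓ ∘ₗ E c with hφdef
  have hφu : φ u' = 1 := by rw [hφdef, LinearMap.comp_apply, hπu, hℓ]
  have hπeq : φ.smulRight u' = E c := by
    refine LinearMap.ext fun x => ?_
    obtain ⟨r, hr⟩ := hline_le _ (hEapply_mem c hc x)
    rw [LinearMap.smulRight_apply, hφdef, LinearMap.comp_apply, hr, map_smul, hℓ, smul_eq_mul, mul_one]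
  have he : φ.smulRight u' ∈ 𝔩 := by rw [hπeq]; exact hE𝔩 c
  have htop𝔩 := SymplecticThetaSix.eq_top_of_rankOne_idempotent 𝔩 h𝔩br h𝔩1 h𝔩irr hφu he
  intro A'
  exact (hmem𝔩 A').1 (htop𝔩 ▸ Submodule.mem_top)

end RankOne

/-! ### §3 Splitting a raising operator along the spectral projector of its Levi operator -/

section Split

variable {V : Type u} [AddCommGroup V] [Module ℚ V] {n : ℤ}

set_option maxHeartbeats 1600000 in
/-- **Splitting lemma.** Let `B ∈ 𝔤_ℂ` be raising with conjugate `C = B̄`, and suppose the Levi operator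
`BC|_P` (`P = V^{1,0}`) is `x E_x + y E_y` for complementary idempotents `E_x, E_y` of `P` lying in the Levi
line algebra (restrictions of elements of `𝔤_ℂ`), with `x ≠ y` real. Then the involution `Θ' = E_x − E_y` has a
degree-`0` lift `Z₀ ∈ 𝔤_ℂ` (preserving `P` and `Q = V^{0,1}`) with `Z₀ ∘ conj = −conj ∘ Z₀` (by `ψ`-duality:
`E_x`, `E_y` are self-adjoint for `ψ_ℂ(x, conj y)`, their ranges being eigenspaces of the self-adjoint `BC|_P`
for the distinct real eigenvalues `x, y`), and **`B₁ := ½B + ¼[Z₀, B] ∈ 𝔤_ℂ` is a raising operator with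
`B₁(conj p) = B(conj E_x p)`, `B̄₁ p = C(E_x p)` and Levi operator `B₁B̄₁|_P = x E_x`** (`B` maps `conj E_x P`
into `E_x P`, as `BC` and `CB = conj ∘ BC ∘ conj` are intertwined by `B`). [cite: MoonenZarhin1999LowDim, §2 (2.3)]
[cite: GoodmanWallachGTM255, §2.1.2 and §4.1.1] [cite: Deligne1982HodgeCycles, I §3 Prop. 3.4] -/
theorem SymplecticThetaEight.exists_split_raise [Module.Finite ℚ V] (H : HodgeStructure V n) (hn : n = 1)
    (heff : H.IsEffective) (ψ : H.Polarization)
    (𝔤 : Submodule ℚ (Module.End ℚ V)) (hbr : ∀ X ∈ 𝔤, ∀ X' ∈ 𝔤, X * X' - X' * X ∈ 𝔤)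
    {Θ : Module.End ℂ (ℂ ⊗[ℚ] V)} (hΘ : ∀ p, ∀ x ∈ H.piece p (n - p), Θ x = ((2 * p - n : ℤ) : ℂ) • x)
    (hΘ𝔤 : Θ ∈ spanC 𝔤) (hskew : ∀ X ∈ 𝔤, ∀ v w, ψ.form (X v) w + ψ.form v (X w) = 0)
    {B C : Module.End ℂ (ℂ ⊗[ℚ] V)} (hB𝔤 : B ∈ spanC 𝔤)
    (hBP : ∀ p ∈ H.piece 1 0, B p = 0) (hBim : ∀ v, B v ∈ H.piece 1 0) (hC : ∀ v, C v = conj (B (conj v)))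
    {x y : ℂ} (hxy : x ≠ y) (hxr : starRingEnd ℂ x = x) (hyr : starRingEnd ℂ y = y) :
    ∀ ⦃Ex Ey : Module.End ℂ ↥(H.piece 1 0)⦄, Ex + Ey = 1 → Ex * Ex = Ex → Ex * Ey = 0 → Ey * Ex = 0 →
    (∀ p : ↥(H.piece 1 0), B (C p) = x • ((Ex p : ↥(H.piece 1 0)) : ℂ ⊗[ℚ] V) +
      y • ((Ey p : ↥(H.piece 1 0)) : ℂ ⊗[ℚ] V)) →
    (∃ Z ∈ spanC 𝔤, ∀ p : ↥(H.piece 1 0), ((Ex p : ↥(H.piece 1 0)) : ℂ ⊗[ℚ] V) = Z p) →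
    (∃ Z ∈ spanC 𝔤, ∀ p : ↥(H.piece 1 0), ((Ey p : ↥(H.piece 1 0)) : ℂ ⊗[ℚ] V) = Z p) →
    ∃ Z₀ ∈ spanC 𝔤, ∃ B₁ ∈ spanC 𝔤, ∃ C₁ : Module.End ℂ (ℂ ⊗[ℚ] V),
      (∀ p ∈ H.piece 1 0, Z₀ p ∈ H.piece 1 0) ∧ (∀ q ∈ H.piece 0 1, Z₀ q ∈ H.piece 0 1) ∧
      (∀ p : ↥(H.piece 1 0), Z₀ p = ((Ex p : ↥(H.piece 1 0)) : ℂ ⊗[ℚ] V) - ((Ey p : ↥(H.piece 1 0)) : ℂ ⊗[ℚ] V)) ∧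
      (∀ v, Z₀ (conj v) = -conj (Z₀ v)) ∧
      (∀ p ∈ H.piece 1 0, B₁ p = 0) ∧ (∀ v, B₁ v ∈ H.piece 1 0) ∧ (∀ v, C₁ v = conj (B₁ (conj v))) ∧
      (∀ p : ↥(H.piece 1 0), B₁ (conj (p : ℂ ⊗[ℚ] V)) = B (conj ((Ex p : ↥(H.piece 1 0)) : ℂ ⊗[ℚ] V))) ∧
      (∀ p : ↥(H.piece 1 0), C₁ p = C ((Ex p : ↥(H.piece 1 0)) : ℂ ⊗[ℚ] V)) ∧
      (∀ p : ↥(H.piece 1 0), B₁ (C₁ p) = x • ((Ex p : ↥(H.piece 1 0)) : ℂ ⊗[ℚ] V)) ∧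
      (∀ p b : ↥(H.piece 1 0), (b : ℂ ⊗[ℚ] V) = B (conj ((Ex p : ↥(H.piece 1 0)) : ℂ ⊗[ℚ] V)) → Ex b = b) ∧
      (∀ u w : ↥(H.piece 1 0), ψ.form.baseChange ℂ ((Ex u : ↥(H.piece 1 0)) : ℂ ⊗[ℚ] V)
        (conj ((Ey w : ↥(H.piece 1 0)) : ℂ ⊗[ℚ] V)) = 0) := by
  classical
  subst hn
  obtain ⟨hPmem, hQmem, hΘ10, hΘ01, hΘΘ⟩ := UnitaryTheta.theta_facts H rfl heff hΘ
  set P := H.piece 1 0 with hPdef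
  set Q := H.piece 0 1 with hQdef
  set M := ℂ ⊗[ℚ] V
  set ω := ψ.form.baseChange ℂ with hω
  intro Ex Ey hsum hExx hExy hEyx hA hEx𝔩 hEy𝔩
  have hωnd : ω.Nondegenerate := ψ.nondegenerate_baseChange
  have hωalt : ∀ a b, ω a b = -ω b a := fun a b => by
    rw [hω, ψ.form_baseChange_swap b a, Int.negOnePow_odd 1 odd_one]
    norm_num
  have hPQ : ∀ v ∈ P, conj v ∈ Q := fun v hv => conj_mem_piece H hv
  have hQP : ∀ v ∈ Q, conj v ∈ P := fun v hv => conj_mem_piece H hv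
  have h𝔊br : ∀ Z ∈ spanC 𝔤, ∀ Z' ∈ spanC 𝔤, Z * Z' - Z' * Z ∈ spanC 𝔤 := fun Z hZ Z' hZ' =>
    commutator_mem_spanC hbr hZ hZ'
  have h𝔊skew : ∀ Z ∈ spanC 𝔤, ∀ a b, ω (Z a) b + ω a (Z b) = 0 := fun Z hZ =>
    ThetaSubalgebra.formBaseChange_add_eq_zero_of_mem_spanC ψ hskew hZ
  have hBskew := h𝔊skew B hB𝔤
  obtain ⟨hCQ, hCim, hcC, hcB⟩ := SymplecticThetaTen.conjOp_raise hPQ hQP hBP hBim hC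
  have hQQ : ∀ q ∈ Q, ∀ q' ∈ Q, ω q q' = 0 := fun q hq q' hq' =>
    ψ.form_piece_piece (p := 0) (p' := 0) (by norm_num) (by rw [sub_zero]; exact hq) (by rw [sub_zero]; exact hq')
  have hPQv : ∀ v : M, (2 : ℂ)⁻¹ • (v + Θ v) + (2 : ℂ)⁻¹ • (v - Θ v) = v := fun v => by module
  -- pointwise forms of the idempotent identities
  have hsumv : ∀ p : ↥P, Ex p + Ey p = p := fun p => by
    rw [← LinearMap.add_apply, hsum, Module.End.one_apply]
  have hsumM : ∀ p : ↥P, ((Ex p : ↥P) : M) + ((Ey p : ↥P) : M) = p := fun p => by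
    rw [← Submodule.coe_add, hsumv]
  have hExxv : ∀ p : ↥P, Ex (Ex p) = Ex p := fun p => by rw [← Module.End.mul_apply, hExx]
  have hExyv : ∀ p : ↥P, Ex (Ey p) = 0 := fun p => by rw [← Module.End.mul_apply, hExy, LinearMap.zero_apply]
  have hEyxv : ∀ p : ↥P, Ey (Ex p) = 0 := fun p => by rw [← Module.End.mul_apply, hEyx, LinearMap.zero_apply]
  have hEyyv : ∀ p : ↥P, Ey (Ey p) = Ey p := fun p => by
    have h := hsumv (Ey p)
    rw [hExyv, zero_add] at h
    exact h
  -- the Levi operator on eigenvectors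
  have hAEx : ∀ p : ↥P, B (C ((Ex p : ↥P) : M)) = x • ((Ex p : ↥P) : M) := fun p => by
    rw [hA, hExxv, hEyxv, Submodule.coe_zero, smul_zero, add_zero]
  have hAEy : ∀ p : ↥P, B (C ((Ey p : ↥P) : M)) = y • ((Ey p : ↥P) : M) := fun p => by
    rw [hA, hExyv, hEyyv, Submodule.coe_zero, smul_zero, zero_add]
  -- the self-adjointness of `B C` for `s(x, y) = ψ_ℂ(x, conj y)`
  have hsa : ∀ p p' : ↥P, ω (B (C p)) (conj (p' : M)) = ω (p : M) (conj (B (C p'))) := fun p p' =>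
    (SymplecticThetaTen.form_mul_conjOp_conj ψ.form hC hBskew (p : M) (p' : M)).1
  -- `s`-orthogonality of the two eigenspaces
  have horth : ∀ u w : ↥P, ω ((Ex u : ↥P) : M) (conj ((Ey w : ↥P) : M)) = 0 := by
    intro u w
    have h := hsa (Ex u) (Ey w)
    rw [hAEx, hAEy, map_smul, LinearMap.smul_apply, conj_smul, hyr, map_smul, smul_eq_mul, smul_eq_mul] at h
    have h' : (x - y) * ω ((Ex u : ↥P) : M) (conj ((Ey w : ↥P) : M)) = 0 := by rw [sub_mul, h, sub_self]
    exact (mul_eq_zero.1 h').resolve_left (sub_ne_zero.2 hxy)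
  have horth' : ∀ u w : ↥P, ω ((Ey u : ↥P) : M) (conj ((Ex w : ↥P) : M)) = 0 := by
    intro u w
    have h := hsa (Ey u) (Ex w)
    rw [hAEy, hAEx, map_smul, LinearMap.smul_apply, conj_smul, hxr, map_smul, smul_eq_mul, smul_eq_mul] at h
    have h' : (y - x) * ω ((Ey u : ↥P) : M) (conj ((Ex w : ↥P) : M)) = 0 := by rw [sub_mul, h, sub_self]
    exact (mul_eq_zero.1 h').resolve_left (sub_ne_zero.2 (Ne.symm hxy))
  -- self-adjointness of `Θ' = Ex − Ey` for `s`
  have hΘ'sa : ∀ u w : ↥P, ω (((Ex u : ↥P) : M) - ((Ey u : ↥P) : M)) (conj (w : M)) =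
      ω (u : M) (conj (((Ex w : ↥P) : M) - ((Ey w : ↥P) : M))) := by
    intro u w
    have hw : conj (w : M) = conj ((Ex w : ↥P) : M) + conj ((Ey w : ↥P) : M) := by rw [← map_add, hsumM]
    have hu : (u : M) = ((Ex u : ↥P) : M) + ((Ey u : ↥P) : M) := (hsumM u).symm
    rw [hw, hu, map_sub conj]
    simp only [map_add, map_sub, LinearMap.add_apply, LinearMap.sub_apply, horth, horth']
    ring
  -- the lift `Z₀` of `Θ'`
  obtain ⟨Zx, hZx, hZxE⟩ := hEx𝔩
  obtain ⟨Zy, hZy, hZyE⟩ := hEy𝔩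
  set Z : Module.End ℂ M := Zx - Zy with hZdef
  have hZ𝔊 : Z ∈ spanC 𝔤 := Submodule.sub_mem _ hZx hZy
  have hZP : ∀ p : ↥P, Z p = ((Ex p : ↥P) : M) - ((Ey p : ↥P) : M) := fun p => by
    rw [hZdef, LinearMap.sub_apply, ← hZxE, ← hZyE]
  obtain ⟨Zm, -, Z₀, hZ₀𝔊, Zp, -, -, -, -, -, -, hZ₀P, -, hZ₀PP, hZ₀QQ⟩ :=
    SymplecticTheta.exists_decomp (spanC 𝔤) h𝔊br hΘ𝔤 hΘΘ hΘ10 hΘ01 hPmem hQmem hZ𝔊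
  have hZ₀apply : ∀ p : ↥P, Z₀ p = ((Ex p : ↥P) : M) - ((Ey p : ↥P) : M) := fun p => by
    have hZpP : Z p ∈ P := by rw [hZP]; exact Submodule.sub_mem _ (Ex p).2 (Ey p).2
    rw [hZ₀P p p.2, hΘ10 _ hZpP, ← two_smul ℂ (Z (p : M)), smul_smul, inv_mul_cancel₀ (two_ne_zero' ℂ),
      one_smul, hZP]
  have hZ₀skew := h𝔊skew Z₀ hZ₀𝔊
  -- `Z₀ (conj p) = −conj (Z₀ p)` on `P`, by `ψ`-duality
  have hZ₀conjP : ∀ p : ↥P, Z₀ (conj (p : M)) = -conj (Z₀ p) := by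
    intro p
    have hw : Z₀ (conj (p : M)) + conj (Z₀ p) ∈ Q :=
      Submodule.add_mem _ (hZ₀QQ _ (hPQ _ p.2)) (hPQ _ (hZ₀PP _ p.2))
    rw [eq_neg_iff_add_eq_zero]
    refine hωnd.1 _ fun v => ?_
    rw [← hPQv v, map_add, hQQ _ hw _ (hQmem v), add_zero]
    set v' : ↥P := ⟨(2 : ℂ)⁻¹ • (v + Θ v), hPmem v⟩ with hv'
    have hv'c : ((2 : ℂ)⁻¹ • (v + Θ v) : M) = (v' : M) := rfl
    rw [hv'c, map_add, LinearMap.add_apply]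
    have h1 : ω (Z₀ (conj (p : M))) (v' : M) = -ω (conj (p : M)) (Z₀ v') := by
      have h := hZ₀skew (conj (p : M)) (v' : M); linear_combination h
    have h2 : ω (conj (Z₀ p)) (v' : M) = -ω (v' : M) (conj (Z₀ p)) := hωalt _ _
    have h3 : ω (conj (p : M)) (Z₀ v') = -ω (Z₀ v') (conj (p : M)) := hωalt _ _
    rw [h1, h2, h3, hZ₀apply, hZ₀apply, hΘ'sa v' p]
    ring
  have hZ₀conj : ∀ v, Z₀ (conj v) = -conj (Z₀ v) := by
    intro v
    set p' : ↥P := ⟨(2 : ℂ)⁻¹ • (v + Θ v), hPmem v⟩ with hp'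
    set p'' : ↥P := ⟨conj ((2 : ℂ)⁻¹ • (v - Θ v)), hQP _ (hQmem v)⟩ with hp''
    have h1 : ((2 : ℂ)⁻¹ • (v + Θ v) : M) = (p' : M) := rfl
    have h2 : ((2 : ℂ)⁻¹ • (v - Θ v) : M) = conj (p'' : M) := by rw [hp'']; exact (conj_conj _).symm
    rw [← hPQv v, h1, h2, map_add, map_add, map_add, map_add, neg_add, hZ₀conjP p', conj_conj, hZ₀conjP p'',
      map_neg, conj_conj, neg_neg]
  -- `B` maps `conj (E_x P)` into `E_x P` and `conj (E_y P)` into `E_y P`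
  have hBconj : ∀ p : ↥P, B (conj (p : M)) = conj (C p) := fun p => (hcC p).symm
  have hCB : ∀ p : ↥P, C (B (conj (p : M))) = conj (B (C p)) := fun p => by
    rw [hBconj, hC, conj_conj]
  have hAop : ∀ p : ↥P, (⟨B (C p), hBim _⟩ : ↥P) = x • Ex p + y • Ey p := fun p => by
    apply Subtype.ext
    change B (C p) = _
    rw [Submodule.coe_add, Submodule.coe_smul, Submodule.coe_smul]
    exact hA p
  have hbx : ∀ p b : ↥P, (b : M) = B (conj ((Ex p : ↥P) : M)) → Ex b = b := by
    intro p b hb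
    have hAb : (⟨B (C b), hBim _⟩ : ↥P) = x • b := by
      apply Subtype.ext
      change B (C b) = ((x • b : ↥P) : M)
      rw [Submodule.coe_smul, hb, hCB, hAEx, conj_smul, hxr, map_smul]
    rw [hAop b] at hAb
    have h2 : Ey (x • Ex b + y • Ey b) = Ey (x • b) := by rw [hAb]
    simp only [map_add, map_smul, hEyxv, hEyyv, smul_zero, zero_add] at h2
    have h3 : (y - x) • Ey b = 0 := (sub_smul y x (Ey b)).trans (sub_eq_zero.2 h2)
    have hEyb : Ey b = 0 := (smul_eq_zero.1 h3).resolve_left (sub_ne_zero.2 (Ne.symm hxy))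
    have h := hsumv b
    rw [hEyb, add_zero] at h
    exact h
  have hby : ∀ p b : ↥P, (b : M) = B (conj ((Ey p : ↥P) : M)) → Ex b = 0 := by
    intro p b hb
    have hAb : (⟨B (C b), hBim _⟩ : ↥P) = y • b := by
      apply Subtype.ext
      change B (C b) = ((y • b : ↥P) : M)
      rw [Submodule.coe_smul, hb, hCB, hAEy, conj_smul, hyr, map_smul]
    rw [hAop b] at hAb
    have h1 : Ex (x • Ex b + y • Ey b) = Ex (y • b) := by rw [hAb]
    simp only [map_add, map_smul, hExxv, hExyv, smul_zero, add_zero] at h1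
    have h3 : (x - y) • Ex b = 0 := (sub_smul x y (Ex b)).trans (sub_eq_zero.2 h1)
    exact (smul_eq_zero.1 h3).resolve_left (sub_ne_zero.2 hxy)
  have hZ₀bx : ∀ p : ↥P, Z₀ (B (conj ((Ex p : ↥P) : M))) = B (conj ((Ex p : ↥P) : M)) := by
    intro p
    set b : ↥P := ⟨B (conj ((Ex p : ↥P) : M)), hBim _⟩ with hb
    have hbc : (b : M) = B (conj ((Ex p : ↥P) : M)) := rfl
    have hExb : Ex b = b := hbx p b hbc
    have hEyb : Ey b = 0 := by
      have h' := hsumv b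
      rw [hExb] at h'
      have := congrArg (fun z : ↥P => z - b) h'
      simpa using this
    have h := hZ₀apply b
    rw [hExb, hEyb, Submodule.coe_zero, sub_zero] at h
    rw [← hbc, h]
  have hZ₀by : ∀ p : ↥P, Z₀ (B (conj ((Ey p : ↥P) : M))) = -B (conj ((Ey p : ↥P) : M)) := by
    intro p
    set b : ↥P := ⟨B (conj ((Ey p : ↥P) : M)), hBim _⟩ with hb
    have hbc : (b : M) = B (conj ((Ey p : ↥P) : M)) := rfl
    have hExb : Ex b = 0 := hby p b hbc
    have hEyb : Ey b = b := by
      have h' := hsumv b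
      rw [hExb, zero_add] at h'
      exact h'
    have h := hZ₀apply b
    rw [hExb, hEyb, Submodule.coe_zero, zero_sub] at h
    rw [← hbc, h]
  -- the split raising operator `B₁ = ½ B + ¼ [Z₀, B]`
  set B₁ : Module.End ℂ M := (2 : ℂ)⁻¹ • B + (4 : ℂ)⁻¹ • (Z₀ * B - B * Z₀) with hB₁def
  have hB₁𝔊 : B₁ ∈ spanC 𝔤 :=
    Submodule.add_mem _ (Submodule.smul_mem _ _ hB𝔤) (Submodule.smul_mem _ _ (h𝔊br _ hZ₀𝔊 _ hB𝔤))
  have hB₁apply : ∀ v, B₁ v = (2 : ℂ)⁻¹ • B v + (4 : ℂ)⁻¹ • (Z₀ (B v) - B (Z₀ v)) := fun v => rfl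
  have hB₁P : ∀ p ∈ P, B₁ p = 0 := fun p hp => by
    rw [hB₁apply, hBP p hp, hBP _ (hZ₀PP p hp), map_zero, smul_zero, sub_zero, smul_zero, add_zero]
  have hB₁im : ∀ v, B₁ v ∈ P := fun v => by
    rw [hB₁apply]
    exact Submodule.add_mem _ (Submodule.smul_mem _ _ (hBim v))
      (Submodule.smul_mem _ _ (Submodule.sub_mem _ (hZ₀PP _ (hBim v)) (hBim _)))
  have hB₁conj : ∀ p : ↥P, B₁ (conj (p : M)) = B (conj ((Ex p : ↥P) : M)) := by
    intro p
    have hsplit : conj (p : M) = conj ((Ex p : ↥P) : M) + conj ((Ey p : ↥P) : M) := by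
      rw [← map_add, hsumM]
    rw [hB₁apply, hZ₀conj, hZ₀apply, hsplit]
    simp only [map_add, map_sub, map_neg, hZ₀bx, hZ₀by]
    module
  obtain ⟨C₁, hC₁⟩ := exists_conjOp B₁
  have hC₁apply : ∀ p : ↥P, C₁ p = C ((Ex p : ↥P) : M) := fun p => by
    rw [hC₁, hB₁conj, hC]
  have hLevi : ∀ p : ↥P, B₁ (C₁ p) = x • ((Ex p : ↥P) : M) := by
    intro p
    set b : ↥P := ⟨B (conj ((Ex p : ↥P) : M)), hBim _⟩ with hb
    have hbc : (b : M) = B (conj ((Ex p : ↥P) : M)) := rfl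
    have hExb : Ex b = b := hbx p b hbc
    have h1 : C ((Ex p : ↥P) : M) = conj (b : M) := by rw [hbc, hC]
    rw [hC₁apply, h1, hB₁conj b, hExb, hbc, ← hC, hAEx]
  refine ⟨Z₀, hZ₀𝔊, B₁, hB₁𝔊, C₁, hZ₀PP, hZ₀QQ, hZ₀apply, hZ₀conj, hB₁P, hB₁im, hC₁, hB₁conj, hC₁apply, hLevi,
    hbx, horth⟩

end Split

/-! ### §4 Two lemmas of plane linear algebra -/

section Plane

variable {W : Type*} [AddCommGroup W] [Module ℂ W]

/-- In a plane `S`, a non-zero vector `w₀` and a vector `w₁ ∉ ℂ w₀` span. [folklore] -/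
private theorem SymplecticThetaEight.exists_pair_repr {S : Submodule ℂ W} (hS : Module.finrank ℂ S = 2)
    {w₀ w₁ : W} (hw₀ : w₀ ∈ S) (hw₁ : w₁ ∈ S) (hw₀0 : w₀ ≠ 0) (hw₁0 : w₁ ∉ Submodule.span ℂ ({w₀} : Set W))
    {v : W} (hv : v ∈ S) : ∃ a b : ℂ, a • w₀ + b • w₁ = v := by
  haveI : FiniteDimensional ℂ S := Module.finite_of_finrank_eq_succ hS
  have hle : Submodule.span ℂ ({w₀, w₁} : Set W) ≤ S := by
    rw [Submodule.span_le]
    rintro z (rfl | rfl)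
    · exact hw₀
    · exact hw₁
  haveI : FiniteDimensional ℂ ↥(Submodule.span ℂ ({w₀, w₁} : Set W)) := Submodule.finiteDimensional_of_le hle
  have h1 : Module.finrank ℂ ↥(Submodule.span ℂ ({w₀} : Set W)) = 1 := finrank_span_singleton hw₀0
  have hlt : Submodule.span ℂ ({w₀} : Set W) < Submodule.span ℂ ({w₀, w₁} : Set W) := by
    refine lt_of_le_of_ne (Submodule.span_mono (Set.singleton_subset_iff.2 (Set.mem_insert _ _))) fun h => ?_
    exact hw₁0 (h ▸ Submodule.subset_span (Set.mem_insert_of_mem _ (Set.mem_singleton _)))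
  have h2 := Submodule.finrank_lt_finrank_of_lt hlt
  have h3 := Submodule.finrank_mono hle
  rw [h1] at h2
  rw [hS] at h3
  have heq : Submodule.span ℂ ({w₀, w₁} : Set W) = S := Submodule.eq_of_le_of_finrank_eq hle (by rw [hS]; omega)
  rw [← heq] at hv
  exact Submodule.mem_span_pair.1 hv

/-- A plane `S` contains a vector outside any given line. [folklore] -/
private theorem SymplecticThetaEight.exists_not_mem_span {S : Submodule ℂ W} (hS : Module.finrank ℂ S = 2)
    (w₀ : W) : ∃ w₁ ∈ S, w₁ ∉ Submodule.span ℂ ({w₀} : Set W) := by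
  haveI : FiniteDimensional ℂ S := Module.finite_of_finrank_eq_succ hS
  by_contra h
  push Not at h
  have hle : S ≤ Submodule.span ℂ ({w₀} : Set W) := fun z hz => h z hz
  have h1 := Submodule.finrank_mono hle
  rw [hS] at h1
  by_cases hw₀ : w₀ = 0
  · rw [hw₀, Submodule.span_singleton_eq_bot.2 rfl, finrank_bot] at h1
    omega
  · rw [finrank_span_singleton hw₀] at h1
    omega

/-- **A symmetric bilinear form on a complex plane has a non-zero isotropic vector** (a binary quadratic form
over an algebraically closed field represents zero). [cite: HoffmanKunze1971LinearAlgebra, §10.2] -/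
theorem SymplecticThetaEight.exists_isotropic (β : W →ₗ[ℂ] W →ₗ[ℂ] ℂ) (hβ : ∀ u v, β u v = β v u)
    {S : Submodule ℂ W} (hS : Module.finrank ℂ S = 2) : ∃ v₀ ∈ S, v₀ ≠ 0 ∧ β v₀ v₀ = 0 := by
  haveI : FiniteDimensional ℂ S := Module.finite_of_finrank_eq_succ hS
  obtain ⟨u₀, hu₀S, hu₀0⟩ : ∃ u₀ ∈ S, u₀ ≠ 0 := by
    have hne : S ≠ ⊥ := fun h => by rw [h, finrank_bot] at hS; exact absurd hS (by norm_num)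
    exact (Submodule.ne_bot_iff _).1 hne
  by_cases hu₀ : β u₀ u₀ = 0
  · exact ⟨u₀, hu₀S, hu₀0, hu₀⟩
  obtain ⟨w, hwS, hw⟩ := SymplecticThetaEight.exists_not_mem_span hS u₀
  set a := β u₀ u₀ with ha
  set b := β u₀ w with hb
  set c := β w w with hc
  obtain ⟨r, hr⟩ := IsAlgClosed.exists_eq_mul_self (b * b - a * c)
  set t := (-b + r) / a with ht
  have hat : a * t = -b + r := by rw [ht, mul_div_cancel₀ _ hu₀]
  refine ⟨w + t • u₀, Submodule.add_mem _ hwS (Submodule.smul_mem _ _ hu₀S), fun h0 => ?_, ?_⟩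
  · apply hw
    rw [Submodule.mem_span_singleton]
    exact ⟨-t, by rw [neg_smul, neg_eq_iff_add_eq_zero, add_comm]; exact h0⟩
  · have hwu : β w u₀ = b := by rw [hb, hβ]
    simp only [map_add, map_smul, LinearMap.add_apply, LinearMap.smul_apply, smul_eq_mul]
    rw [hwu, ← ha, ← hb, ← hc]
    have key : a * (c + t * b + (b + t * a) * t) = 0 := by
      have : a * (c + t * b + (b + t * a) * t) = a * c + 2 * b * (a * t) + (a * t) * (a * t) := by ring
      rw [this, hat, ← sub_eq_zero]
      have : a * c + 2 * b * (-b + r) + (-b + r) * (-b + r) - 0 = r * r - (b * b - a * c) := by ring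
      rw [this, hr, sub_self]
    have := (mul_eq_zero.1 key).resolve_left hu₀
    linear_combination this

/-- **The orthogonal of a non-zero isotropic vector in a non-degenerate symmetric plane is its own line.**
[cite: HoffmanKunze1971LinearAlgebra, §10.2] -/
theorem SymplecticThetaEight.mem_span_of_orthogonal_isotropic (β : W →ₗ[ℂ] W →ₗ[ℂ] ℂ)
    (hβ : ∀ u v, β u v = β v u) {S : Submodule ℂ W} (hS : Module.finrank ℂ S = 2)
    (hnd : ∀ u ∈ S, (∀ v ∈ S, β u v = 0) → u = 0) {v₀ : W} (hv₀S : v₀ ∈ S) (hv₀0 : v₀ ≠ 0)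
    (hv₀ : β v₀ v₀ = 0) {w : W} (hwS : w ∈ S) (hw : β w v₀ = 0) : w ∈ Submodule.span ℂ ({v₀} : Set W) := by
  obtain ⟨w', hw'S, hw'⟩ : ∃ w' ∈ S, β v₀ w' ≠ 0 := by
    by_contra h
    push Not at h
    exact hv₀0 (hnd v₀ hv₀S h)
  have hw'v : β w' v₀ ≠ 0 := by rwa [hβ]
  have hw'0 : w' ∉ Submodule.span ℂ ({v₀} : Set W) := by
    intro h
    obtain ⟨a, rfl⟩ := Submodule.mem_span_singleton.1 h
    apply hw'v
    rw [map_smul, LinearMap.smul_apply, hv₀, smul_eq_mul, mul_zero]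
  obtain ⟨a, b, hab⟩ := SymplecticThetaEight.exists_pair_repr hS hv₀S hw'S hv₀0 hw'0 hwS
  have hb : b = 0 := by
    have h := hw
    rw [← hab, map_add, map_smul, map_smul, LinearMap.add_apply, LinearMap.smul_apply, LinearMap.smul_apply, hv₀,
      smul_eq_mul, mul_zero, zero_add, smul_eq_mul] at h
    exact (mul_eq_zero.1 h).resolve_right hw'v
  rw [Submodule.mem_span_singleton]
  exact ⟨a, by rw [← hab, hb, zero_smul, add_zero]⟩

end Plane

/-! ### §5 The pattern `(2,2)`: pencil and rigidity -/

section TwoTwo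

variable {V : Type u} [AddCommGroup V] [Module ℚ V] {n : ℤ}

set_option maxHeartbeats 4000000 in
/-- **The `(2,2)` pattern forces `𝔩 = End(V^{1,0})`.** Standing hypotheses as in
`SymplecticThetaTen.levi_eq_top_or_scalar` (`End_Hdg(V) = ℚ`), plus the data of the splitting lemma: the Levi
operator `BB̄|_P = x E_x + y E_y` with `x ≠ y` real, `x ≠ 0`, and `dim E_x P = 2`. Then the Levi line algebra
is `End(V^{1,0})`. PROOF. Let `Z₀, B₁` be as in `exists_split_raise`. (PENCIL) If some degree-`0` `Z' ∈ 𝔤_ℂ`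
commuting with `Z₀` has `[Z', B₁] ∉ ℂB₁`: the raising operators `B_t = [Z', B₁] − tB₁ ∈ 𝔤_ℂ` kill `P` and
`conj E_y P` and map `conj E_x P` into `E_x P`; for `t = conj(λ)/x`, `λ` an eigenvalue of the LINEAR operator
`w ↦ B(conj([Z', B₁](conj w)))` of the plane `E_x P`, `B_t` kills a non-zero vector, so `B_t ≠ 0` has Levi
operator of rank `≤ 1` and `levi_eq_top_of_rankOne` applies. (RIGIDITY) Otherwise `[Z', B₁] = μB₁` for all
such `Z'`; conjugating, `[Z', B̄₁] = μ̄' B̄₁`, so on `E_x P` every such `Z'` is `β`-skew up to a scalar for the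
non-degenerate symmetric form `β(u, v) = ψ_ℂ(B̄ u, v)`; an isotropic `v₀ ≠ 0` of `β` (`exists_isotropic`) spans
a line stable under all of them (`mem_span_of_orthogonal_isotropic`), in particular under the `Θ'`-diagonal
part of every element of `𝔩` (lifted to `Z − ¼[Z₀,[Z₀,Z]]`, which commutes with `Z₀` by
`eq_zero_of_skew_of_apply_piece_eq_zero`); the orbit lemma `SymplecticThetaSix.eq_bot_or_eq_of_stable_le` for
(`P`, `𝔩`, `Θ' = E_x − E_y`) then forces `ℂv₀ = E_x P`, contradicting `dim E_x P = 2`.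
[cite: MoonenZarhin1999LowDim, Thm. (0.1)(3) and §2 (2.5)(1)] [cite: MoonenZarhin1995Duke, §2 (type I(1))]
[cite: Mumford1969NoteShimura, §4] [cite: GoodmanWallachGTM255, §2.1.2 and §4.1.1]
[cite: Deligne1982HodgeCycles, I §3 Prop. 3.4 and Prop. 3.6] -/
theorem SymplecticThetaEight.levi_eq_top_of_twoTwo [Module.Finite ℚ V] (H : HodgeStructure V n) (hn : n = 1)
    (heff : H.IsEffective) (ψ : H.Polarization) (hE : ∀ a ∈ H.endAlg, ∃ x : ℚ, a = x • 1)
    (𝔤 : Submodule ℚ (Module.End ℚ V)) (hbr : ∀ X ∈ 𝔤, ∀ X' ∈ 𝔤, X * X' - X' * X ∈ 𝔤)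
    {Θ : Module.End ℂ (ℂ ⊗[ℚ] V)} (hΘ : ∀ p, ∀ x ∈ H.piece p (n - p), Θ x = ((2 * p - n : ℤ) : ℂ) • x)
    (hΘ𝔤 : Θ ∈ spanC 𝔤) (hskew : ∀ X ∈ 𝔤, ∀ v w, ψ.form (X v) w + ψ.form v (X w) = 0)
    {B C : Module.End ℂ (ℂ ⊗[ℚ] V)} (hB𝔤 : B ∈ spanC 𝔤)
    (hBP : ∀ p ∈ H.piece 1 0, B p = 0) (hBim : ∀ v, B v ∈ H.piece 1 0) (hC : ∀ v, C v = conj (B (conj v)))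
    ⦃x y : ℂ⦄ (hxy : x ≠ y) (hx0 : x ≠ 0) (hxr : starRingEnd ℂ x = x) (hyr : starRingEnd ℂ y = y) :
    ∀ ⦃Ex Ey : Module.End ℂ ↥(H.piece 1 0)⦄, Ex + Ey = 1 → Ex * Ex = Ex → Ex * Ey = 0 → Ey * Ex = 0 →
    (∀ p : ↥(H.piece 1 0), B (C p) = x • ((Ex p : ↥(H.piece 1 0)) : ℂ ⊗[ℚ] V) +
      y • ((Ey p : ↥(H.piece 1 0)) : ℂ ⊗[ℚ] V)) →
    (∃ Z ∈ spanC 𝔤, ∀ p : ↥(H.piece 1 0), ((Ex p : ↥(H.piece 1 0)) : ℂ ⊗[ℚ] V) = Z p) →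
    (∃ Z ∈ spanC 𝔤, ∀ p : ↥(H.piece 1 0), ((Ey p : ↥(H.piece 1 0)) : ℂ ⊗[ℚ] V) = Z p) →
    Module.finrank ℂ ↥(LinearMap.range Ex) = 2 →
    ∀ A : Module.End ℂ ↥(H.piece 1 0), ∃ Z ∈ spanC 𝔤, ∀ p : ↥(H.piece 1 0),
      ((A p : ↥(H.piece 1 0)) : ℂ ⊗[ℚ] V) = Z p := by
  classical
  have hirr : ∀ U : Submodule ℂ (ℂ ⊗[ℚ] V), (∀ Z ∈ spanC 𝔤, ∀ u ∈ U, Z u ∈ U) → U = ⊥ ∨ U = ⊤ :=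
    fun U hU => SymplecticTheta.eq_bot_or_top_of_stable H hn heff ψ hE 𝔤 hΘ hΘ𝔤 hskew
      fun X hX u hu => hU _ (baseChange_mem_spanC hX) u hu
  have hsplit := SymplecticThetaEight.exists_split_raise H hn heff ψ 𝔤 hbr hΘ hΘ𝔤 hskew hB𝔤 hBP hBim hC hxy
    hxr hyr
  have hrk1 := fun (B' C' : Module.End ℂ (ℂ ⊗[ℚ] V)) (hB'𝔤 : B' ∈ spanC 𝔤) (hB'0 : B' ≠ 0)
    (hB'P : ∀ p ∈ H.piece 1 0, B' p = 0) (hB'im : ∀ v, B' v ∈ H.piece 1 0)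
    (hC' : ∀ v, C' v = conj (B' (conj v))) =>
    SymplecticThetaEight.levi_eq_top_of_rankOne H hn heff ψ hE 𝔤 hbr hΘ hΘ𝔤 hskew hB'𝔤 hB'0 hB'P hB'im hC'
  subst hn
  obtain ⟨hPmem, hQmem, hΘ10, hΘ01, hΘΘ⟩ := UnitaryTheta.theta_facts H rfl heff hΘ
  set P := H.piece 1 0 with hPdef
  set Q := H.piece 0 1 with hQdef
  set M := ℂ ⊗[ℚ] V
  set ω := ψ.form.baseChange ℂ with hω
  intro Ex Ey hsum hExx hExy hEyx hA hEx𝔩 hEy𝔩 hPa2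
  obtain ⟨Z₀, hZ₀𝔊, B₁, hB₁𝔊, C₁, hZ₀PP, hZ₀QQ, hZ₀apply, hZ₀conj, hB₁P, hB₁im, hC₁, hB₁conj, hC₁apply, hLevi,
    hbx, horth⟩ := hsplit hsum hExx hExy hEyx hA hEx𝔩 hEy𝔩
  -- standing facts
  have hωnd : ω.Nondegenerate := ψ.nondegenerate_baseChange
  have hωalt : ∀ a b, ω a b = -ω b a := fun a b => by
    rw [hω, ψ.form_baseChange_swap b a, Int.negOnePow_odd 1 odd_one]
    norm_num
  have hPQ : ∀ v ∈ P, conj v ∈ Q := fun v hv => conj_mem_piece H hv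
  have hQP : ∀ v ∈ Q, conj v ∈ P := fun v hv => conj_mem_piece H hv
  have h𝔊br : ∀ Z ∈ spanC 𝔤, ∀ Z' ∈ spanC 𝔤, Z * Z' - Z' * Z ∈ spanC 𝔤 := fun Z hZ Z' hZ' =>
    commutator_mem_spanC hbr hZ hZ'
  have h𝔊skew : ∀ Z ∈ spanC 𝔤, ∀ a b, ω (Z a) b + ω a (Z b) = 0 := fun Z hZ =>
    ThetaSubalgebra.formBaseChange_add_eq_zero_of_mem_spanC ψ hskew hZ
  have hBskew := h𝔊skew B hB𝔤
  obtain ⟨hCQ, hCim, hcC, hcB⟩ := SymplecticThetaTen.conjOp_raise hPQ hQP hBP hBim hC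
  have hC𝔊 : C ∈ spanC 𝔤 := conjOp_mem_spanC hB𝔤 hC
  have hCskew := h𝔊skew C hC𝔊
  have hQQ : ∀ q ∈ Q, ∀ q' ∈ Q, ω q q' = 0 := fun q hq q' hq' =>
    ψ.form_piece_piece (p := 0) (p' := 0) (by norm_num) (by rw [sub_zero]; exact hq) (by rw [sub_zero]; exact hq')
  have hPQv : ∀ v : M, (2 : ℂ)⁻¹ • (v + Θ v) + (2 : ℂ)⁻¹ • (v - Θ v) = v := fun v => by module
  have hdec := fun Z (hZ : Z ∈ spanC 𝔤) =>
    SymplecticTheta.exists_decomp (spanC 𝔤) h𝔊br hΘ𝔤 hΘΘ hΘ10 hΘ01 hPmem hQmem hZ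
  -- pointwise idempotent identities
  have hsumv : ∀ p : ↥P, Ex p + Ey p = p := fun p => by
    rw [← LinearMap.add_apply, hsum, Module.End.one_apply]
  have hsumM : ∀ p : ↥P, ((Ex p : ↥P) : M) + ((Ey p : ↥P) : M) = p := fun p => by
    rw [← Submodule.coe_add, hsumv]
  have hExxv : ∀ p : ↥P, Ex (Ex p) = Ex p := fun p => by rw [← Module.End.mul_apply, hExx]
  have hExyv : ∀ p : ↥P, Ex (Ey p) = 0 := fun p => by rw [← Module.End.mul_apply, hExy, LinearMap.zero_apply]
  have hEyxv : ∀ p : ↥P, Ey (Ex p) = 0 := fun p => by rw [← Module.End.mul_apply, hEyx, LinearMap.zero_apply]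
  have hEy_of_Ex : ∀ p : ↥P, Ex p = p → Ey p = 0 := fun p hp => by
    have h := hsumv p
    rw [hp] at h
    have := congrArg (fun z : ↥P => z - p) h
    simpa using this
  have hmem_range : ∀ p : ↥P, p ∈ LinearMap.range Ex ↔ Ex p = p := by
    intro p
    constructor
    · rintro ⟨q, rfl⟩; exact hExxv q
    · intro h; exact ⟨p, h⟩
  have hAEx : ∀ p : ↥P, Ex p = p → B (C p) = x • (p : M) := fun p hp => by
    rw [hA, hEy_of_Ex p hp, hp, Submodule.coe_zero, smul_zero, add_zero]
  -- `E_x` in terms of `Z₀`: `E_x p = ½ (Z₀ p + p)`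
  have hExZ₀ : ∀ p : ↥P, ((Ex p : ↥P) : M) = (2 : ℂ)⁻¹ • (Z₀ p + p) := fun p => by
    rw [hZ₀apply]
    have h := hsumM p
    have h' : ((Ey p : ↥P) : M) = (p : M) - ((Ex p : ↥P) : M) := by rw [← h]; abel
    rw [h']
    module
  -- degree-zero operators commuting with `Z₀` commute with `E_x` on `P`
  have hExW : ∀ W : Module.End ℂ M, (∀ p ∈ P, W p ∈ P) → W * Z₀ = Z₀ * W →
      ∀ (p : ↥P) (hWp : W p ∈ P), ((Ex ⟨W p, hWp⟩ : ↥P) : M) = W ((Ex p : ↥P) : M) := by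
    intro W hWP hWZ p hWp
    rw [hExZ₀, hExZ₀, map_smul, map_add]
    change (2 : ℂ)⁻¹ • (Z₀ (W p) + W p) = (2 : ℂ)⁻¹ • (W (Z₀ p) + W p)
    rw [← Module.End.mul_apply, ← hWZ, Module.End.mul_apply]
  -- the conjugate of a degree-zero operator commuting with `Z₀`
  have hconjW : ∀ W : Module.End ℂ M, W ∈ spanC 𝔤 → (∀ p ∈ P, W p ∈ P) → (∀ q ∈ Q, W q ∈ Q) →
      W * Z₀ = Z₀ * W → ∀ Wb : Module.End ℂ M, (∀ v, Wb v = conj (W (conj v))) →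
      Wb ∈ spanC 𝔤 ∧ (∀ p ∈ P, Wb p ∈ P) ∧ (∀ q ∈ Q, Wb q ∈ Q) ∧ Wb * Z₀ = Z₀ * Wb := by
    intro W hW𝔊 hWP hWQ hWZ Wb hWb
    refine ⟨conjOp_mem_spanC hW𝔊 hWb, fun p hp => ?_, fun q hq => ?_, LinearMap.ext fun v => ?_⟩
    · rw [hWb]; exact hQP _ (hWQ _ (hPQ p hp))
    · rw [hWb]; exact hPQ _ (hWP _ (hQP q hq))
    · have e1 : conj (Z₀ v) = -Z₀ (conj v) := by rw [hZ₀conj, neg_neg]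
      calc (Wb * Z₀) v = conj (W (conj (Z₀ v))) := by rw [Module.End.mul_apply, hWb]
        _ = -conj (W (Z₀ (conj v))) := by rw [e1, map_neg, map_neg]
        _ = -conj (Z₀ (W (conj v))) := by rw [← Module.End.mul_apply W Z₀, hWZ, Module.End.mul_apply]
        _ = Z₀ (conj (W (conj v))) := by rw [hZ₀conj]
        _ = (Z₀ * Wb) v := by rw [Module.End.mul_apply, hWb]
  -- a non-zero vector of `E_x P`, and `B₁ ≠ 0`
  have hPane : LinearMap.range Ex ≠ ⊥ := fun h => by
    rw [h, finrank_bot] at hPa2; exact absurd hPa2 (by norm_num)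
  obtain ⟨p₀, hp₀mem, hp₀0⟩ := (Submodule.ne_bot_iff _).1 hPane
  have hp₀ : Ex p₀ = p₀ := (hmem_range p₀).1 hp₀mem
  have hB₁0 : B₁ ≠ 0 := by
    intro h0
    have h := hLevi p₀
    rw [h0, LinearMap.zero_apply, hp₀] at h
    have h' : (x • p₀ : ↥P) = 0 := Subtype.ext (by rw [Submodule.coe_smul, ← h, Submodule.coe_zero])
    exact hp₀0 ((smul_eq_zero.1 h').resolve_left hx0)
  -- `B ∘ conj` maps `E_x P` into `E_x P`
  have hgx : ∀ w : ↥P, Ex w = w → Ex ⟨B (conj (w : M)), hBim _⟩ = ⟨B (conj (w : M)), hBim _⟩ := by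
    intro w hw
    have h := hbx w ⟨B (conj (w : M)), hBim _⟩ (by rw [hw])
    exact h
  ------------------------------------------------------------------
  -- THE CASE SPLIT: is `[Z', B₁] ∈ ℂ B₁` for every degree-zero `Z' ∈ 𝔤_ℂ` commuting with `Z₀`?
  ------------------------------------------------------------------
  by_cases hdeg : ∀ Z' ∈ spanC 𝔤, (∀ p ∈ P, Z' p ∈ P) → (∀ q ∈ Q, Z' q ∈ Q) → Z' * Z₀ = Z₀ * Z' →
      ∃ μ : ℂ, Z' * B₁ - B₁ * Z' = μ • B₁
  swap
  · ----------------------------------------------------------------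
    -- PENCIL: a rank-one raising operator
    ----------------------------------------------------------------
    push Not at hdeg
    obtain ⟨Z', hZ'𝔊, hZ'P, hZ'Q, hZ'Z, hnot⟩ := hdeg
    obtain ⟨Zb, hZb⟩ := exists_conjOp Z'
    obtain ⟨hZb𝔊, hZbP, hZbQ, hZbZ⟩ := hconjW Z' hZ'𝔊 hZ'P hZ'Q hZ'Z Zb hZb
    set B'' : Module.End ℂ M := Z' * B₁ - B₁ * Z' with hB''def
    have hB''𝔊 : B'' ∈ spanC 𝔤 := h𝔊br _ hZ'𝔊 _ hB₁𝔊
    have hB''apply : ∀ v, B'' v = Z' (B₁ v) - B₁ (Z' v) := fun v => rfl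
    have hB''P : ∀ p ∈ P, B'' p = 0 := fun p hp => by
      rw [hB''apply, hB₁P p hp, map_zero, hB₁P _ (hZ'P p hp), sub_zero]
    have hB''im : ∀ v, B'' v ∈ P := fun v => by
      rw [hB''apply]; exact Submodule.sub_mem _ (hZ'P _ (hB₁im v)) (hB₁im _)
    -- `B'' (conj w) = Z' (B (conj (E_x w))) − B (conj (Zb (E_x w)))`
    have hB''conj : ∀ w : ↥P, B'' (conj (w : M)) =
        Z' (B (conj ((Ex w : ↥P) : M))) - B (conj (Zb ((Ex w : ↥P) : M))) := by
      intro w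
      have h1 : Z' (conj (w : M)) = conj (Zb w) := by rw [hZb, conj_conj]
      have hZbw : Zb w ∈ P := hZbP _ w.2
      rw [hB''apply, hB₁conj, h1, hB₁conj ⟨Zb w, hZbw⟩, hExW Zb hZbP hZbZ w hZbw]
    -- the antilinear maps through `conj` preserve `E_x P`
    have hfix_B : ∀ w : ↥P, Ex w = w → ∀ hb : B (conj (w : M)) ∈ P, Ex ⟨B (conj (w : M)), hb⟩ = ⟨_, hb⟩ :=
      fun w hw hb => hgx w hw
    have hfix_Z' : ∀ w : ↥P, Ex w = w → ∀ hz : Z' w ∈ P, Ex ⟨Z' w, hz⟩ = ⟨_, hz⟩ := by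
      intro w hw hz
      apply Subtype.ext
      rw [hExW Z' hZ'P hZ'Z w hz, hw]
    have hfix_Zb : ∀ w : ↥P, Ex w = w → ∀ hz : Zb w ∈ P, Ex ⟨Zb w, hz⟩ = ⟨_, hz⟩ := by
      intro w hw hz
      apply Subtype.ext
      rw [hExW Zb hZbP hZbZ w hz, hw]
    have hfix_B'' : ∀ w : ↥P, Ex w = w → ∀ hb : B'' (conj (w : M)) ∈ P, Ex ⟨B'' (conj (w : M)), hb⟩ = ⟨_, hb⟩ := by
      intro w hw hb
      have hzb : Zb w ∈ P := hZbP _ w.2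
      have h1 : B (conj (w : M)) ∈ P := hBim _
      have h2 : Z' (B (conj (w : M))) ∈ P := hZ'P _ h1
      have h3 : B (conj (Zb w)) ∈ P := hBim _
      have e1 := hfix_Z' ⟨B (conj (w : M)), h1⟩ (hfix_B w hw h1) h2
      have e2 := hfix_B ⟨Zb w, hzb⟩ (hfix_Zb w hw hzb) h3
      have hval : (⟨B'' (conj (w : M)), hb⟩ : ↥P) = ⟨Z' (B (conj (w : M))), h2⟩ - ⟨B (conj (Zb w)), h3⟩ := by
        apply Subtype.ext
        rw [Submodule.coe_sub]
        change B'' (conj (w : M)) = Z' (B (conj (w : M))) - B (conj (Zb w))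
        rw [hB''conj, hw]
      rw [hval, map_sub, e1, e2]
    -- the pencil `B_t = B'' − t B₁` evaluated on `conj (E_x P)`
    have hBt_conj : ∀ (t : ℂ) (w : ↥P), Ex w = w →
        (B'' - t • B₁) (conj (w : M)) = B'' (conj (w : M)) - t • B (conj (w : M)) := by
      intro t w hw
      rw [LinearMap.sub_apply, LinearMap.smul_apply, hB₁conj, hw]
    -- the linear operator `F w = B (conj (B'' (conj w)))` on `E_x P`
    let F : ↥P →ₗ[ℂ] ↥P :=
      { toFun := fun w => ⟨B (conj (B'' (conj (w : M)))), hBim _⟩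
        map_add' := fun w w' => by
          apply Subtype.ext
          simp only [Submodule.coe_add, map_add]
        map_smul' := fun c w => by
          apply Subtype.ext
          change B (conj (B'' (conj ((c • w : ↥P) : M)))) = ((c • (⟨B (conj (B'' (conj (w : M)))), hBim _⟩ : ↥P) : ↥P) : M)
          rw [Submodule.coe_smul, Submodule.coe_smul, conj_smul, map_smul, conj_smul, starRingEnd_self_apply,
            map_smul] }
    have hFapply : ∀ w : ↥P, ((F w : ↥P) : M) = B (conj (B'' (conj (w : M)))) := fun w => rfl
    have hFrange : ∀ w ∈ LinearMap.range Ex, F w ∈ LinearMap.range Ex := by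
      intro w hw
      rw [hmem_range] at hw ⊢
      have hb : B'' (conj (w : M)) ∈ P := hB''im _
      have e := hfix_B ⟨B'' (conj (w : M)), hb⟩ (hfix_B'' w hw hb) (hBim _)
      exact e
    haveI : Nontrivial ↥(LinearMap.range Ex) := Module.nontrivial_of_finrank_pos (by rw [hPa2]; norm_num)
    set Fr : Module.End ℂ ↥(LinearMap.range Ex) := F.restrict hFrange with hFrdef
    obtain ⟨lam, hlam⟩ := Module.End.exists_eigenvalue (K := ℂ) (V := ↥(LinearMap.range Ex)) Fr
    obtain ⟨w₀', hw₀'⟩ := hlam.exists_hasEigenvector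
    set w₀ : ↥P := (w₀' : ↥P) with hw₀def
    have hw₀mem : w₀ ∈ LinearMap.range Ex := w₀'.2
    have hw₀ : Ex w₀ = w₀ := (hmem_range w₀).1 hw₀mem
    have hw₀0 : w₀ ≠ 0 := fun h => hw₀'.2 (Subtype.ext h)
    have hFw₀ : F w₀ = lam • w₀ := by
      have h := Module.End.mem_eigenspace_iff.1 hw₀'.1
      have h' := congrArg (fun z : ↥(LinearMap.range Ex) => (z : ↥P)) h
      simpa only [hFrdef, LinearMap.coe_restrict_apply, Submodule.coe_smul] using h'
    -- the parameter `t` with `B_t (conj w₀) = 0`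
    set t : ℂ := starRingEnd ℂ lam / x with htdef
    set B' : Module.End ℂ M := B'' - t • B₁ with hB'def
    have hB'𝔊 : B' ∈ spanC 𝔤 := Submodule.sub_mem _ hB''𝔊 (Submodule.smul_mem _ _ hB₁𝔊)
    have hB'P : ∀ p ∈ P, B' p = 0 := fun p hp => by
      rw [hB'def, LinearMap.sub_apply, LinearMap.smul_apply, hB''P p hp, hB₁P p hp, smul_zero, sub_zero]
    have hB'im : ∀ v, B' v ∈ P := fun v => by
      rw [hB'def, LinearMap.sub_apply, LinearMap.smul_apply]
      exact Submodule.sub_mem _ (hB''im v) (Submodule.smul_mem _ _ (hB₁im v))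
    have hB'0 : B' ≠ 0 := fun h0 => hnot t (by rw [← sub_eq_zero]; exact h0)
    -- `B' (conj w) ∈ E_x P` for `w ∈ E_x P`, and `B' (conj w)` depends only on `E_x w`
    have hB'conj_Ex : ∀ w : ↥P, B' (conj (w : M)) = B' (conj ((Ex w : ↥P) : M)) := by
      intro w
      simp only [hB'def, LinearMap.sub_apply, LinearMap.smul_apply]
      rw [hB₁conj, hB₁conj, hExxv, hB''conj, hB''conj, hExxv]
    have hfix_B' : ∀ w : ↥P, Ex w = w → Ex ⟨B' (conj (w : M)), hB'im _⟩ = ⟨B' (conj (w : M)), hB'im _⟩ := by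
      intro w hw
      have hb : B'' (conj (w : M)) ∈ P := hB''im _
      have hval : (⟨B' (conj (w : M)), hB'im _⟩ : ↥P) =
          ⟨B'' (conj (w : M)), hb⟩ - t • ⟨B (conj (w : M)), hBim _⟩ := by
        apply Subtype.ext
        rw [Submodule.coe_sub, Submodule.coe_smul]
        exact hBt_conj t w hw
      rw [hval, map_sub, map_smul, hfix_B'' w hw hb, hfix_B w hw (hBim _)]
    -- `B' (conj w₀) = 0`: apply the injective antilinear `v ↦ B (conj v)` of `E_x P`
    have hkill : B' (conj (w₀ : M)) = 0 := by
      -- `B (conj (B' (conj w₀))) = (lam − conj t · x) w₀ = 0`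
      have h1 : B (conj (B' (conj (w₀ : M)))) = 0 := by
        rw [hBt_conj t w₀ hw₀, map_sub, map_sub, conj_smul, map_smul, ← hFapply, hFw₀, Submodule.coe_smul]
        have h2 : B (conj (B (conj (w₀ : M)))) = x • (w₀ : M) := by
          have h3 : conj (B (conj (w₀ : M))) = C w₀ := (hC _).symm
          rw [h3, hAEx w₀ hw₀]
        rw [h2, htdef, map_div₀, starRingEnd_self_apply, hxr, smul_smul, div_mul_cancel₀ _ hx0, sub_self]
      -- injectivity: `B (conj v) = 0`, `v ∈ E_x P` ⟹ `x v = B (C v) = 0`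
      set v : ↥P := ⟨B' (conj (w₀ : M)), hB'im _⟩ with hvdef
      have hvfix : Ex v = v := hfix_B' w₀ hw₀
      have hv0 : (v : M) = 0 := by
        have h4 : B (C v) = x • (v : M) := hAEx v hvfix
        have h5 : C v = conj (B (conj (v : M))) := hC _
        have h6 : B (conj (v : M)) = 0 := h1
        rw [h5, h6, map_zero, map_zero] at h4
        exact ((smul_eq_zero.1 h4.symm).resolve_left hx0)
      exact hv0
    -- the Levi operator of `B'` has rank `≤ 1`
    obtain ⟨w₁, hw₁mem, hw₁⟩ := SymplecticThetaEight.exists_not_mem_span hPa2 w₀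
    have hw₁fix : Ex w₁ = w₁ := (hmem_range w₁).1 hw₁mem
    obtain ⟨C', hC'⟩ := exists_conjOp B'
    have hrk : ∃ u ∈ P, ∀ p ∈ P, ∃ r : ℂ, B' (C' p) = r • u := by
      refine ⟨B' (conj (w₁ : M)), hB'im _, fun p hp => ?_⟩
      -- `C' p = conj (B' (conj p))` with `B' (conj p) ∈ E_x P`
      set v : ↥P := ⟨B' (conj p), hB'im _⟩ with hvdef
      have hvfix : Ex v = v := by
        have h := hfix_B' (Ex ⟨p, hp⟩) (hExxv _)
        have e : B' (conj ((Ex ⟨p, hp⟩ : ↥P) : M)) = B' (conj p) := (hB'conj_Ex ⟨p, hp⟩).symm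
        have hv' : v = ⟨B' (conj ((Ex ⟨p, hp⟩ : ↥P) : M)), hB'im _⟩ := Subtype.ext e.symm
        rw [hv']; exact h
      have hvmem : v ∈ LinearMap.range Ex := (hmem_range v).2 hvfix
      obtain ⟨a, b, hab⟩ := SymplecticThetaEight.exists_pair_repr hPa2 hw₀mem hw₁mem hw₀0 hw₁ hvmem
      refine ⟨starRingEnd ℂ b, ?_⟩
      have h1 : C' p = conj (v : M) := hC' p
      have h2 : (v : M) = a • (w₀ : M) + b • (w₁ : M) := by
        rw [← hab, Submodule.coe_add, Submodule.coe_smul, Submodule.coe_smul]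
      rw [h1, h2, map_add, conj_smul, conj_smul, map_add, map_smul, map_smul, hkill, smul_zero, zero_add]
    exact hrk1 B' C' hB'𝔊 hB'0 hB'P hB'im hC' hrk
  · ----------------------------------------------------------------
    -- RIGIDITY: a common eigenvector, contradicting the orbit lemma
    ----------------------------------------------------------------
    exfalso
    -- the symmetric form `β(u, v) = ψ_ℂ(C u, v)`
    let β : M →ₗ[ℂ] M →ₗ[ℂ] ℂ := ω.compl₂ C ∘ₗ C
    have hβapply' : ∀ u v : M, β u v = ω (C u) (C v) := fun u v => rfl
    -- (we use instead the form `ω (C u) v`; define it as a bilinear map)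
    let γ : M →ₗ[ℂ] M →ₗ[ℂ] ℂ := ω ∘ₗ C
    have hγ : ∀ u v : M, γ u v = ω (C u) v := fun u v => rfl
    have hγsymm : ∀ u v : M, γ u v = γ v u := fun u v => by
      rw [hγ, hγ]
      have h1 := hCskew u v
      have h2 := hωalt u (C v)
      linear_combination h1 - h2
    -- the form restricted to `P`, through the subtype
    let γP : ↥P →ₗ[ℂ] ↥P →ₗ[ℂ] ℂ := γ.compl₁₂ P.subtype P.subtype
    have hγP : ∀ u v : ↥P, γP u v = ω (C u) v := fun u v => rfl
    have hγPsymm : ∀ u v : ↥P, γP u v = γP v u := fun u v => hγsymm u v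
    -- (★) for degree-zero `Z' ∈ 𝔤_ℂ` commuting with `Z₀`: `γ(Z'u, v) + γ(u, Z'v) + μ γ(u, v) = 0` on `E_x P`
    have hstar : ∀ Z' ∈ spanC 𝔤, (∀ p ∈ P, Z' p ∈ P) → (∀ q ∈ Q, Z' q ∈ Q) → Z' * Z₀ = Z₀ * Z' →
        ∃ μ : ℂ, ∀ u v : ↥P, Ex u = u → Ex v = v →
          ω (C (Z' u)) v + ω (C u) (Z' v) + μ * ω (C u) v = 0 := by
      intro Z' hZ'𝔊 hZ'P hZ'Q hZ'Z
      obtain ⟨Zb, hZb⟩ := exists_conjOp Z'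
      obtain ⟨hZb𝔊, hZbP, hZbQ, hZbZ⟩ := hconjW Z' hZ'𝔊 hZ'P hZ'Q hZ'Z Zb hZb
      obtain ⟨μ, hμ⟩ := hdeg Zb hZb𝔊 hZbP hZbQ hZbZ
      refine ⟨starRingEnd ℂ μ, fun u v hu hv => ?_⟩
      -- conjugate `[Zb, B₁] = μ B₁` at `conj u`: `Z' (C₁ u) − C₁ (Z' u) = conj μ • C₁ u`
      have h1 := LinearMap.congr_fun hμ (conj (u : M))
      rw [LinearMap.sub_apply, Module.End.mul_apply, Module.End.mul_apply, LinearMap.smul_apply] at h1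
      have h2 := congrArg conj h1
      rw [map_sub, conj_smul, hZb, conj_conj, ← hC₁] at h2
      -- `B₁ (Zb (conj u)) = B₁ (conj (Z' u))`, so its conjugate is `C₁ (Z' u)`
      have h3 : Zb (conj (u : M)) = conj (Z' u) := by rw [hZb, conj_conj]
      rw [h3, ← hC₁] at h2
      -- `C₁ = C ∘ E_x` on `P`
      have hZ'u : Z' u ∈ P := hZ'P _ u.2
      have hC₁u : C₁ u = C u := by rw [hC₁apply, hu]
      have hC₁Zu : C₁ (Z' u) = C (Z' u) := by
        have h := hC₁apply ⟨Z' u, hZ'u⟩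
        have e : Ex ⟨Z' u, hZ'u⟩ = ⟨Z' u, hZ'u⟩ := by
          apply Subtype.ext; rw [hExW Z' hZ'P hZ'Z u hZ'u, hu]
        rw [e] at h
        exact h
      rw [hC₁u, hC₁Zu] at h2
      -- pair with `v`
      have h4 := congrArg (fun z => ω z (v : M)) h2
      simp only [map_sub, map_smul, LinearMap.sub_apply, LinearMap.smul_apply, smul_eq_mul] at h4
      have h5 := h𝔊skew Z' hZ'𝔊 (C u) (v : M)
      linear_combination -h4 + h5
    -- non-degeneracy of `γ` on `E_x P`
    have hnd : ∀ u ∈ LinearMap.range Ex, (∀ v ∈ LinearMap.range Ex, γP u v = 0) → u = 0 := by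
      intro u hu huv
      rw [hmem_range] at hu
      have hCu : C u = 0 := by
        refine hωnd.1 _ fun z => ?_
        rw [← hPQv z, map_add, hQQ _ (hCim _) _ (hQmem z), add_zero]
        set p : ↥P := ⟨(2 : ℂ)⁻¹ • (z + Θ z), hPmem z⟩ with hpdef
        have hp : ((2 : ℂ)⁻¹ • (z + Θ z) : M) = (p : M) := rfl
        rw [hp, ← hsumM p, map_add]
        have h1 : ω (C u) ((Ex p : ↥P) : M) = 0 := huv (Ex p) ⟨p, rfl⟩
        have h2 : ω (C u) ((Ey p : ↥P) : M) = 0 := by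
          -- `C u = conj (B (conj u))` with `B (conj u) ∈ E_x P`, orthogonal to `conj E_y P`
          have h3 : C u = conj (B (conj (u : M))) := hC _
          have hb : Ex ⟨B (conj (u : M)), hBim _⟩ = ⟨B (conj (u : M)), hBim _⟩ := hgx u hu
          have h4 := horth ⟨B (conj (u : M)), hBim _⟩ p
          rw [hb] at h4
          -- `ω (conj b, Ey p) = −conj (ω (Ey p ... ))`: use `ω(conj a, c) = conj ω(a, conj c)`
          have h5 : ω (conj (B (conj (u : M)))) ((Ey p : ↥P) : M) =
              starRingEnd ℂ (ω (B (conj (u : M))) (conj ((Ey p : ↥P) : M))) := by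
            rw [← form_baseChange_conj, conj_conj]
          rw [h3, h5]
          change starRingEnd ℂ (ω ((⟨B (conj (u : M)), hBim _⟩ : ↥P) : M) (conj ((Ey p : ↥P) : M))) = 0
          rw [h4, map_zero]
        rw [h1, h2, add_zero]
      have h := hAEx u hu
      rw [hCu, map_zero] at h
      have h' : (u : M) = 0 := (smul_eq_zero.1 h.symm).resolve_left hx0
      exact Subtype.ext h'
    -- an isotropic vector `v₀ ∈ E_x P`
    obtain ⟨v₀, hv₀mem, hv₀0, hv₀⟩ := SymplecticThetaEight.exists_isotropic γP hγPsymm hPa2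
    have hv₀fix : Ex v₀ = v₀ := (hmem_range v₀).1 hv₀mem
    -- every degree-zero `Z' ∈ 𝔤_ℂ` commuting with `Z₀` maps `v₀` into `ℂ v₀`
    have hline : ∀ (Z' : Module.End ℂ M) (_ : Z' ∈ spanC 𝔤) (hZ'P : ∀ p ∈ P, Z' p ∈ P)
        (_ : ∀ q ∈ Q, Z' q ∈ Q) (_ : Z' * Z₀ = Z₀ * Z'),
        (⟨Z' v₀, hZ'P _ v₀.2⟩ : ↥P) ∈ Submodule.span ℂ ({v₀} : Set ↥P) := by
      intro Z' hZ'𝔊 hZ'P hZ'Q hZ'Z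
      obtain ⟨μ, hμ⟩ := hstar Z' hZ'𝔊 hZ'P hZ'Q hZ'Z
      have hZv : Ex ⟨Z' v₀, hZ'P _ v₀.2⟩ = ⟨Z' v₀, hZ'P _ v₀.2⟩ := by
        apply Subtype.ext; rw [hExW Z' hZ'P hZ'Z v₀ (hZ'P _ v₀.2), hv₀fix]
      have hZvmem : (⟨Z' v₀, hZ'P _ v₀.2⟩ : ↥P) ∈ LinearMap.range Ex := (hmem_range _).2 hZv
      refine SymplecticThetaEight.mem_span_of_orthogonal_isotropic γP hγPsymm hPa2 hnd hv₀mem hv₀0 hv₀ hZvmem ?_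
      have h := hμ v₀ v₀ hv₀fix hv₀fix
      have h0 : ω (C v₀) v₀ = 0 := hv₀
      have hsym : ω (C v₀) (Z' v₀) = ω (C (Z' v₀)) v₀ := hγsymm (v₀ : M) (Z' v₀)
      rw [h0, mul_zero, add_zero, hsym, ← two_mul] at h
      have h' : ω (C (Z' v₀)) v₀ = 0 := (mul_eq_zero.1 h).resolve_left two_ne_zero
      exact h'
    -- the Levi line algebra `𝔩` and the orbit lemma for `Θ' = E_x − E_y`
    let 𝔩 : Submodule ℂ (Module.End ℂ ↥P) :=
      { carrier := {A | ∃ Z ∈ spanC 𝔤, ∀ p : ↥P, ((A p : ↥P) : M) = Z p}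
        zero_mem' := ⟨0, Submodule.zero_mem _, fun p => by simp⟩
        add_mem' := by
          rintro A A' ⟨Z, hZ, hAZ⟩ ⟨Z', hZ', hAZ'⟩
          exact ⟨Z + Z', Submodule.add_mem _ hZ hZ', fun p => by
            rw [LinearMap.add_apply, Submodule.coe_add, hAZ, hAZ', LinearMap.add_apply]⟩
        smul_mem' := by
          rintro c A ⟨Z, hZ, hAZ⟩
          exact ⟨c • Z, Submodule.smul_mem _ _ hZ, fun p => by
            rw [LinearMap.smul_apply, Submodule.coe_smul, hAZ, LinearMap.smul_apply]⟩ }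
    have hmem𝔩 : ∀ A, A ∈ 𝔩 ↔ ∃ Z ∈ spanC 𝔤, ∀ p : ↥P, ((A p : ↥P) : M) = Z p := fun A => Iff.rfl
    have h𝔩br : ∀ A ∈ 𝔩, ∀ A' ∈ 𝔩, A * A' - A' * A ∈ 𝔩 := by
      intro A hA' A' hA''
      obtain ⟨Z, hZ, hAZ⟩ := (hmem𝔩 A).1 hA'
      obtain ⟨Z', hZ', hAZ'⟩ := (hmem𝔩 A').1 hA''
      refine (hmem𝔩 _).2 ⟨Z * Z' - Z' * Z, h𝔊br _ hZ _ hZ', fun p => ?_⟩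
      rw [LinearMap.sub_apply, Submodule.coe_sub, Module.End.mul_apply, Module.End.mul_apply, hAZ, hAZ', hAZ',
        hAZ, LinearMap.sub_apply, Module.End.mul_apply, Module.End.mul_apply]
    have h𝔩irr : ∀ U : Submodule ℂ ↥P, (∀ A ∈ 𝔩, ∀ u ∈ U, A u ∈ U) → U = ⊥ ∨ U = ⊤ := by
      intro U hU
      refine SymplecticThetaSix.levi_irreducible (spanC 𝔤) h𝔊br hΘ𝔤 hΘΘ hΘ10 hΘ01 hPmem hQmem hirr U
        fun Z hZ hZP u hu => ?_
      exact hU _ ((hmem𝔩 _).2 ⟨Z, hZ, fun p => rfl⟩) u hu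
    set Θ' : Module.End ℂ ↥P := Ex - Ey with hΘ'def
    have hΘ'𝔩 : Θ' ∈ 𝔩 := by
      obtain ⟨Zx, hZx, hZxE⟩ := hEx𝔩
      obtain ⟨Zy, hZy, hZyE⟩ := hEy𝔩
      exact (hmem𝔩 _).2 ⟨Zx - Zy, Submodule.sub_mem _ hZx hZy, fun p => by
        rw [hΘ'def, LinearMap.sub_apply, Submodule.coe_sub, hZxE, hZyE, LinearMap.sub_apply]⟩
    have hΘ'apply : ∀ p : ↥P, Θ' p = Ex p - Ey p := fun p => rfl
    have hΘ'Θ' : ∀ p : ↥P, Θ' (Θ' p) = p := fun p => by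
      rw [hΘ'apply, hΘ'apply, map_sub, map_sub, hExxv, hExyv, hEyxv, sub_zero, zero_sub, sub_neg_eq_add]
      have h := hsumv (Ey p)
      rw [hExyv, zero_add] at h
      rw [h, hsumv]
    have hΘ'fix : ∀ p ∈ LinearMap.range Ex, Θ' p = p := fun p hp => by
      rw [hmem_range] at hp
      rw [hΘ'apply, hEy_of_Ex p hp, sub_zero, hp]
    have hΘ'neg : ∀ p ∈ LinearMap.range Ey, Θ' p = -p := by
      rintro _ ⟨q, rfl⟩
      rw [hΘ'apply, hExyv, zero_sub]
      have h := hsumv (Ey q)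
      rw [hExyv, zero_add] at h
      rw [h]
    have hΘ'Pmem : ∀ p : ↥P, (2 : ℂ)⁻¹ • (p + Θ' p) ∈ LinearMap.range Ex := fun p => by
      refine ⟨p, ?_⟩
      rw [hΘ'apply]
      have h' : Ey p = p - Ex p := eq_sub_of_add_eq (by rw [add_comm]; exact hsumv p)
      rw [h']
      module
    have hΘ'Qmem : ∀ p : ↥P, (2 : ℂ)⁻¹ • (p - Θ' p) ∈ LinearMap.range Ey := fun p => by
      refine ⟨p, ?_⟩
      rw [hΘ'apply]
      have h' : Ex p = p - Ey p := eq_sub_of_add_eq (hsumv p)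
      rw [h']
      module
    -- the line `ℂ v₀` is stable under every element of `𝔩` preserving `E_x P`
    set U : Submodule ℂ ↥P := Submodule.span ℂ ({v₀} : Set ↥P) with hUdef
    have hUle : U ≤ LinearMap.range Ex := by
      rw [hUdef, Submodule.span_le, Set.singleton_subset_iff]; exact hv₀mem
    have hUstab : ∀ A ∈ 𝔩, (∀ p ∈ LinearMap.range Ex, A p ∈ LinearMap.range Ex) → ∀ u ∈ U, A u ∈ U := by
      intro A hA𝔩 hAP u hu
      obtain ⟨c, rfl⟩ := Submodule.mem_span_singleton.1 hu
      rw [map_smul]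
      refine Submodule.smul_mem _ _ ?_
      -- a degree-zero lift `Z` of `A`, and the `Θ'`-diagonal lift `Zd = Z − ¼ [Z₀, [Z₀, Z]]`
      obtain ⟨Z, hZ𝔊, hAZ⟩ := (hmem𝔩 A).1 hA𝔩
      obtain ⟨Zm, -, Z0, hZ0𝔊, Zp, -, -, -, -, -, -, hZ0P, -, hZ0PP, hZ0QQ⟩ := hdec Z hZ𝔊
      have hZ0apply : ∀ p : ↥P, Z0 p = ((A p : ↥P) : M) := fun p => by
        have hZpP : Z p ∈ P := by rw [← hAZ]; exact (A p).2
        rw [hZ0P p p.2, hΘ10 _ hZpP, ← two_smul ℂ (Z (p : M)), smul_smul, inv_mul_cancel₀ (two_ne_zero' ℂ),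
          one_smul, hAZ]
      set Zd : Module.End ℂ M := Z0 - (4 : ℂ)⁻¹ • (Z₀ * (Z₀ * Z0 - Z0 * Z₀) - (Z₀ * Z0 - Z0 * Z₀) * Z₀)
        with hZddef
      have hZd𝔊 : Zd ∈ spanC 𝔤 :=
        Submodule.sub_mem _ hZ0𝔊 (Submodule.smul_mem _ _ (h𝔊br _ hZ₀𝔊 _ (h𝔊br _ hZ₀𝔊 _ hZ0𝔊)))
      have hZdapply : ∀ v, Zd v = Z0 v - (4 : ℂ)⁻¹ • (Z₀ (Z₀ (Z0 v)) - Z₀ (Z0 (Z₀ v)) -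
          (Z₀ (Z0 (Z₀ v)) - Z0 (Z₀ (Z₀ v)))) := fun v => by
        rw [hZddef]; simp only [LinearMap.sub_apply, LinearMap.smul_apply, Module.End.mul_apply, map_sub]
      have hZdP : ∀ p ∈ P, Zd p ∈ P := by
        intro p hp
        rw [hZdapply]
        refine Submodule.sub_mem _ (hZ0PP p hp) (Submodule.smul_mem _ _ (Submodule.sub_mem _
          (Submodule.sub_mem _ (hZ₀PP _ (hZ₀PP _ (hZ0PP p hp))) (hZ₀PP _ (hZ0PP _ (hZ₀PP p hp))))
          (Submodule.sub_mem _ (hZ₀PP _ (hZ0PP _ (hZ₀PP p hp))) (hZ0PP _ (hZ₀PP _ (hZ₀PP p hp))))))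
      have hZdQ : ∀ q ∈ Q, Zd q ∈ Q := by
        intro q hq
        rw [hZdapply]
        refine Submodule.sub_mem _ (hZ0QQ q hq) (Submodule.smul_mem _ _ (Submodule.sub_mem _
          (Submodule.sub_mem _ (hZ₀QQ _ (hZ₀QQ _ (hZ0QQ q hq))) (hZ₀QQ _ (hZ0QQ _ (hZ₀QQ q hq))))
          (Submodule.sub_mem _ (hZ₀QQ _ (hZ0QQ _ (hZ₀QQ q hq))) (hZ0QQ _ (hZ₀QQ _ (hZ₀QQ q hq))))))
      -- `Z₀` acts on `P` as `Θ'`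
      have hZ₀Θ' : ∀ p : ↥P, Z₀ p = ((Θ' p : ↥P) : M) := fun p => by
        rw [hZ₀apply, hΘ'apply, Submodule.coe_sub]
      have hZ₀P' : ∀ p : ↥P, Z₀ p ∈ P := fun p => hZ₀PP _ p.2
      -- on `P`, `Zd` is the `Θ'`-diagonal part `½ (A + Θ' A Θ')`
      have hZdP' : ∀ p : ↥P, Zd p = (2 : ℂ)⁻¹ • (((A p : ↥P) : M) + ((Θ' (A (Θ' p)) : ↥P) : M)) := by
        intro p
        have e1 : Z0 (Z₀ p) = ((A (Θ' p) : ↥P) : M) := by rw [hZ₀Θ']; exact hZ0apply (Θ' p)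
        have e2 : Z₀ (Z0 (Z₀ p)) = ((Θ' (A (Θ' p)) : ↥P) : M) := by rw [e1]; exact hZ₀Θ' _
        have e3 : Z₀ (Z0 p) = ((Θ' (A p) : ↥P) : M) := by rw [hZ0apply]; exact hZ₀Θ' _
        have e4 : Z₀ (Z₀ (Z0 p)) = ((A p : ↥P) : M) := by
          rw [e3, hZ₀Θ', hΘ'Θ']
        have e5 : Z0 (Z₀ (Z₀ p)) = ((A p : ↥P) : M) := by
          rw [hZ₀Θ', hZ₀Θ', hΘ'Θ', hZ0apply]
        rw [hZdapply, e4, e2, e5, hZ0apply]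
        module
      -- `Zd` commutes with `Z₀` (check on `P`, then `eq_zero_of_skew_of_apply_piece_eq_zero`)
      have hZdZ : Zd * Z₀ = Z₀ * Zd := by
        rw [← sub_eq_zero]
        set X : Module.End ℂ M := Zd * Z₀ - Z₀ * Zd with hXdef
        have hX𝔊 : X ∈ spanC 𝔤 := h𝔊br _ hZd𝔊 _ hZ₀𝔊
        have hXQ : ∀ q ∈ Q, X q ∈ Q := fun q hq => by
          rw [hXdef, LinearMap.sub_apply, Module.End.mul_apply, Module.End.mul_apply]
          exact Submodule.sub_mem _ (hZdQ _ (hZ₀QQ q hq)) (hZ₀QQ _ (hZdQ q hq))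
        have hXP : ∀ p ∈ P, X p = 0 := by
          intro p hp
          rw [hXdef, LinearMap.sub_apply, Module.End.mul_apply, Module.End.mul_apply]
          have e1 : Zd (Z₀ p) = (2 : ℂ)⁻¹ • (((A (Θ' ⟨p, hp⟩) : ↥P) : M) + ((Θ' (A ⟨p, hp⟩) : ↥P) : M)) := by
            have h := hZdP' (Θ' ⟨p, hp⟩)
            rw [hΘ'Θ'] at h
            rw [show Z₀ p = ((Θ' ⟨p, hp⟩ : ↥P) : M) from hZ₀Θ' ⟨p, hp⟩, h]
          have e2 : Z₀ (Zd p) = (2 : ℂ)⁻¹ • (((Θ' (A ⟨p, hp⟩) : ↥P) : M) + ((A (Θ' ⟨p, hp⟩) : ↥P) : M)) := by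
            have h := hZdP' ⟨p, hp⟩
            rw [show Zd p = (((2 : ℂ)⁻¹ • (A ⟨p, hp⟩ + Θ' (A (Θ' ⟨p, hp⟩))) : ↥P) : M) by
              rw [h, Submodule.coe_smul, Submodule.coe_add], hZ₀Θ', map_smul, map_add, hΘ'Θ', Submodule.coe_smul,
              Submodule.coe_add]
          rw [e1, e2]
          module
        exact SymplecticThetaEight.eq_zero_of_skew_of_apply_piece_eq_zero H rfl heff ψ hΘ (h𝔊skew X hX𝔊) hXQ hXP
      -- hence `Zd v₀ ∈ ℂ v₀`; and `Zd v₀ = A v₀` since `A v₀ ∈ E_x P`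
      have hl := hline Zd hZd𝔊 hZdP hZdQ hZdZ
      have hAv₀ : A v₀ ∈ LinearMap.range Ex := hAP v₀ hv₀mem
      have hZdv₀ : Zd v₀ = ((A v₀ : ↥P) : M) := by
        rw [hZdP', hΘ'fix v₀ hv₀mem, hΘ'fix _ hAv₀]
        module
      have heq : (⟨Zd v₀, hZdP _ v₀.2⟩ : ↥P) = A v₀ := Subtype.ext hZdv₀
      rw [← heq]
      exact hl
    rcases SymplecticThetaSix.eq_bot_or_eq_of_stable_le 𝔩 h𝔩br hΘ'𝔩 hΘ'Θ' hΘ'fix hΘ'neg hΘ'Pmem hΘ'Qmem h𝔩irr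
      U hUle hUstab with hbot | htop
    · have : v₀ ∈ U := Submodule.subset_span (Set.mem_singleton _)
      rw [hbot, Submodule.mem_bot] at this
      exact hv₀0 this
    · have h1 : Module.finrank ℂ ↥U ≤ 1 := by
        rw [hUdef]; exact finrank_span_le_card ({v₀} : Set ↥P) |>.trans (by simp)
      rw [htop, hPa2] at h1
      omega

end TwoTwo

/-! ### §6 The Levi trichotomy in dimension four and the dichotomy in rank eight -/

section Main

variable {V : Type u} [AddCommGroup V] [Module ℚ V] {n : ℤ}

/-- `dim V^{1,0} = dim V^{0,1} = 4` for an effective weight-one Hodge structure of rank `8`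
(`h^{1,0} = h^{0,1}`, `V_ℂ = V^{1,0} ⊕ V^{0,1}`). [cite: Deligne1982HodgeCycles, I §3 (3.1)] -/
theorem SymplecticThetaEight.finrank_pieces_eq_four [Module.Finite ℚ V] (H : HodgeStructure V n) (hn : n = 1)
    (heff : H.IsEffective) (hV : Module.finrank ℚ V = 8) {Θ : Module.End ℂ (ℂ ⊗[ℚ] V)}
    (hΘ : ∀ p, ∀ x ∈ H.piece p (n - p), Θ x = ((2 * p - n : ℤ) : ℂ) • x) :
    Module.finrank ℂ (H.piece 1 0) = 4 ∧ Module.finrank ℂ (H.piece 0 1) = 4 := by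
  subst hn
  obtain ⟨hP, hQ, hΘ10, hΘ01, -⟩ := UnitaryTheta.theta_facts H rfl heff hΘ
  have hPQ : ∀ v, (2 : ℂ)⁻¹ • (v + Θ v) + (2 : ℂ)⁻¹ • (v - Θ v) = v := fun v => by module
  have hsup : H.piece 1 0 ⊔ H.piece 0 1 = ⊤ := by
    rw [eq_top_iff]
    intro v _
    rw [← hPQ v]
    exact Submodule.add_mem_sup (hP v) (hQ v)
  have hinf : H.piece 1 0 ⊓ H.piece 0 1 = ⊥ := by
    rw [eq_bot_iff]
    intro x hx
    rw [Submodule.mem_bot]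
    have h1 := hΘ10 x hx.1
    rw [hΘ01 x hx.2, neg_eq_iff_add_eq_zero, ← two_smul ℂ x, smul_eq_zero] at h1
    exact h1.resolve_left (two_ne_zero' ℂ)
  have hsum := Submodule.finrank_sup_add_finrank_inf_eq (H.piece 1 0) (H.piece 0 1)
  rw [hsup, hinf, finrank_top, finrank_bot, add_zero, Module.finrank_baseChange, hV] at hsum
  have hsymm : Module.finrank ℂ (H.piece 1 0) = Module.finrank ℂ (H.piece 0 1) := hodgeNumber_symm_holds H 1 0
  omega

set_option maxHeartbeats 1600000 in
/-- **The trichotomy in dimension four: the Levi line algebra is everything, or `B B̄|_{V^{1,0}}` is a scalar.**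
Let `H` be an effective polarized weight-one `ℚ`-Hodge structure with `End_Hdg(V) = ℚ` and `dim V^{1,0} = 4`,
`𝔤 ⊆ End_ℚ(V)` bracket-closed and `ψ`-skew with `Θ ∈ 𝔤_ℂ`, `B ∈ 𝔤_ℂ` raising with conjugate `B̄`. Then EITHER
every endomorphism of `V^{1,0}` is the restriction of an element of `𝔤_ℂ`, OR `B B̄` acts on `V^{1,0}` as a
scalar. PROOF: `B B̄|_{V^{1,0}}` is self-adjoint for `ψ_ℂ(x, conj y)`, hence diagonalizable with real spectrum and
spectral projectors in `𝔩`; the multiplicities sum to `4`: one of them is `1` (a rank-one idempotent,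
`SymplecticThetaSix.eq_top_of_rankOne_idempotent`), or there is a single eigenvalue (scalar), or the pattern is
`(2,2)` — `levi_eq_top_of_twoTwo`. [cite: MoonenZarhin1999LowDim, Thm. (0.1)(3) and §2 (2.5)(1)]
[cite: MoonenZarhin1995Duke, §2 (type I(1))] [cite: HoffmanKunze1971LinearAlgebra, §6.7 Thm. 11]
[cite: Deligne1982HodgeCycles, I §3 Prop. 3.4] -/
theorem SymplecticThetaEight.levi_eq_top_or_scalar [Module.Finite ℚ V] (H : HodgeStructure V n) (hn : n = 1)
    (heff : H.IsEffective) (ψ : H.Polarization) (hE : ∀ a ∈ H.endAlg, ∃ x : ℚ, a = x • 1)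
    (𝔤 : Submodule ℚ (Module.End ℚ V)) (hbr : ∀ X ∈ 𝔤, ∀ X' ∈ 𝔤, X * X' - X' * X ∈ 𝔤)
    {Θ : Module.End ℂ (ℂ ⊗[ℚ] V)} (hΘ : ∀ p, ∀ x ∈ H.piece p (n - p), Θ x = ((2 * p - n : ℤ) : ℂ) • x)
    (hΘ𝔤 : Θ ∈ spanC 𝔤) (hskew : ∀ X ∈ 𝔤, ∀ v w, ψ.form (X v) w + ψ.form v (X w) = 0)
    (hP4 : Module.finrank ℂ (H.piece 1 0) = 4) {B C : Module.End ℂ (ℂ ⊗[ℚ] V)} (hB𝔤 : B ∈ spanC 𝔤)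
    (hBP : ∀ p ∈ H.piece 1 0, B p = 0) (hBim : ∀ v, B v ∈ H.piece 1 0) (hC : ∀ v, C v = conj (B (conj v))) :
    (∀ A : Module.End ℂ ↥(H.piece 1 0), ∃ Z ∈ spanC 𝔤, ∀ p : ↥(H.piece 1 0),
        ((A p : ↥(H.piece 1 0)) : ℂ ⊗[ℚ] V) = Z p) ∨
      ∃ μ : ℂ, ∀ p ∈ H.piece 1 0, B (C p) = μ • p := by
  classical
  have haeval := SymplecticThetaTen.aeval_mem_levi H hn heff 𝔤 hbr hΘ hΘ𝔤 hB𝔤 hBP hBim hC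
  have hirr : ∀ U : Submodule ℂ (ℂ ⊗[ℚ] V), (∀ Z ∈ spanC 𝔤, ∀ u ∈ U, Z u ∈ U) → U = ⊥ ∨ U = ⊤ :=
    fun U hU => SymplecticTheta.eq_bot_or_top_of_stable H hn heff ψ hE 𝔤 hΘ hΘ𝔤 hskew
      fun X hX u hu => hU _ (baseChange_mem_spanC hX) u hu
  have htwoTwo := SymplecticThetaEight.levi_eq_top_of_twoTwo H hn heff ψ hE 𝔤 hbr hΘ hΘ𝔤 hskew hB𝔤 hBP hBim hC
  subst hn
  obtain ⟨hPmem, hQmem, hΘ10, hΘ01, hΘΘ⟩ := UnitaryTheta.theta_facts H rfl heff hΘ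
  set P := H.piece 1 0 with hPdef
  set Q := H.piece 0 1 with hQdef
  set M := ℂ ⊗[ℚ] V
  set ω := ψ.form.baseChange ℂ with hω
  have h𝔊br : ∀ Z ∈ spanC 𝔤, ∀ Z' ∈ spanC 𝔤, Z * Z' - Z' * Z ∈ spanC 𝔤 := fun Z hZ Z' hZ' =>
    commutator_mem_spanC hbr hZ hZ'
  have hBskew : ∀ x y, ω (B x) y + ω x (B y) = 0 := fun x y =>
    ThetaSubalgebra.formBaseChange_add_eq_zero_of_mem_spanC ψ hskew hB𝔤 x y
  -- the Levi line algebra `𝔩 ⊆ End(P)`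
  let 𝔩 : Submodule ℂ (Module.End ℂ ↥P) :=
    { carrier := {A | ∃ Z ∈ spanC 𝔤, ∀ p : ↥P, ((A p : ↥P) : M) = Z p}
      zero_mem' := ⟨0, Submodule.zero_mem _, fun p => by simp⟩
      add_mem' := by
        rintro A A' ⟨Z, hZ, hAZ⟩ ⟨Z', hZ', hAZ'⟩
        exact ⟨Z + Z', Submodule.add_mem _ hZ hZ', fun p => by
          rw [LinearMap.add_apply, Submodule.coe_add, hAZ, hAZ', LinearMap.add_apply]⟩
      smul_mem' := by
        rintro c A ⟨Z, hZ, hAZ⟩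
        exact ⟨c • Z, Submodule.smul_mem _ _ hZ, fun p => by
          rw [LinearMap.smul_apply, Submodule.coe_smul, hAZ, LinearMap.smul_apply]⟩ }
  have hmem𝔩 : ∀ A, A ∈ 𝔩 ↔ ∃ Z ∈ spanC 𝔤, ∀ p : ↥P, ((A p : ↥P) : M) = Z p := fun A => Iff.rfl
  have h𝔩br : ∀ A ∈ 𝔩, ∀ A' ∈ 𝔩, A * A' - A' * A ∈ 𝔩 := by
    intro A hA A' hA'
    obtain ⟨Z, hZ, hAZ⟩ := (hmem𝔩 A).1 hA
    obtain ⟨Z', hZ', hAZ'⟩ := (hmem𝔩 A').1 hA'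
    refine (hmem𝔩 _).2 ⟨Z * Z' - Z' * Z, h𝔊br _ hZ _ hZ', fun p => ?_⟩
    rw [LinearMap.sub_apply, Submodule.coe_sub, Module.End.mul_apply, Module.End.mul_apply, hAZ, hAZ', hAZ',
      hAZ, LinearMap.sub_apply, Module.End.mul_apply, Module.End.mul_apply]
  have h𝔩1 : (1 : Module.End ℂ ↥P) ∈ 𝔩 :=
    (hmem𝔩 _).2 ⟨Θ, hΘ𝔤, fun p => by rw [Module.End.one_apply, hΘ10 p p.2]⟩
  have h𝔩irr : ∀ U : Submodule ℂ ↥P, (∀ A ∈ 𝔩, ∀ u ∈ U, A u ∈ U) → U = ⊥ ∨ U = ⊤ := by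
    intro U hU
    refine SymplecticThetaSix.levi_irreducible (spanC 𝔤) h𝔊br hΘ𝔤 hΘΘ hΘ10 hΘ01 hPmem hQmem hirr U
      fun Z hZ hZP u hu => ?_
    exact hU _ ((hmem𝔩 _).2 ⟨Z, hZ, fun p => rfl⟩) u hu
  -- `A = B B̄|_P` and its polynomials
  have hBCP : ∀ x ∈ P, (B * C) x ∈ P := fun x _ => hBim _
  set A : Module.End ℂ ↥P := (B * C).restrict hBCP with hAdef
  have hAapply : ∀ p : ↥P, ((A p : ↥P) : M) = B (C p) := fun p => rfl
  have hA𝔩 : ∀ f : ℂ[X], aeval A f ∈ 𝔩 := by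
    intro f
    obtain ⟨Z, hZ, hZf⟩ := haeval f
    exact (hmem𝔩 _).2 ⟨Z, hZ, fun p => by rw [UnitaryThetaCore.aeval_restrict_coe hBCP f p, hZf p p.2]⟩
  -- the definite pairing `s(x, y) = ψ_ℂ(x, conj y)` on `P`, for which `A` is self-adjoint
  let s : ↥P → ↥P → ℂ := fun x y => ω (x : M) (conj (y : M))
  have hs : ∀ x y : ↥P, s x y = ω (x : M) (conj (y : M)) := fun x y => rfl
  have hsadd₁ : ∀ x y z : ↥P, s (x + y) z = s x z + s y z := fun x y z => by
    rw [hs, hs, hs, Submodule.coe_add, map_add, LinearMap.add_apply]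
  have hssmul₁ : ∀ (c : ℂ) (x z : ↥P), s (c • x) z = c * s x z := fun c x z => by
    rw [hs, hs, Submodule.coe_smul, map_smul, LinearMap.smul_apply, smul_eq_mul]
  have hsadd₂ : ∀ x y z : ↥P, s x (y + z) = s x y + s x z := fun x y z => by
    rw [hs, hs, hs, Submodule.coe_add, map_add, map_add]
  have hssmul₂ : ∀ (c : ℂ) (x y : ↥P), s x (c • y) = starRingEnd ℂ c * s x y := fun c x y => by
    rw [hs, hs, Submodule.coe_smul, conj_smul, map_smul, smul_eq_mul]
  have hsdef : ∀ x : ↥P, s x x = 0 → x = 0 := by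
    intro x hx
    by_contra hx0
    have hx0' : (x : M) ≠ 0 := fun h => hx0 (Subtype.ext h)
    exact ψ.form_conj_ne_zero (p := 1) (q := 0) (by norm_num) x.2 hx0' hx
  have hAsa : ∀ x y : ↥P, s (A x) y = s x (A y) := fun x y => by
    rw [hs, hs, hAapply, hAapply]
    exact (SymplecticThetaTen.form_mul_conjOp_conj ψ.form hC hBskew (x : M) (y : M)).1
  obtain ⟨hreal, -, htop⟩ := SymplecticThetaTen.iSup_eigenspace_eq_top_of_selfAdjoint s hsadd₁ hssmul₁ hsadd₂ hssmul₂
    hsdef A hAsa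
  -- the spectral resolution of `A`
  have hdiag := (Literature.LinearAlgebra.exists_basis_toMatrix_eq_diagonal_iff_iSup_eigenspace_eq_top A).2 htop
  obtain ⟨E, hElag, hAsum, hEsum, hEorth, hEidem, hErange, hEne⟩ :=
    Literature.LinearAlgebra.exists_resolution_of_diagonalizable A hdiag
  set S := A.finite_hasEigenvalue.toFinset with hSdef
  have hE𝔩 : ∀ c, E c ∈ 𝔩 := fun c => by rw [hElag c]; exact hA𝔩 _
  have hEapply_mem : ∀ c ∈ S, ∀ x : ↥P, E c x ∈ A.eigenspace c := fun c hc x => by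
    rw [← hErange c hc]; exact LinearMap.mem_range_self _ _
  -- dimension count `Σ_{c ∈ S} dim Eig_c = 4`
  set d : ℂ → ℕ := fun c => Module.finrank ℂ ↥(A.eigenspace c) with hddef
  have hbiSup : ⨆ c ∈ S, A.eigenspace c = ⊤ := by
    rw [eq_top_iff]
    intro x _
    rw [Literature.LinearAlgebra.eq_sum_resolution_apply hEsum x]
    refine Submodule.sum_mem _ fun c hc => ?_
    exact Submodule.mem_iSup_of_mem c (Submodule.mem_iSup_of_mem hc (hEapply_mem c hc x))
  have hdsum : ∑ c ∈ S, d c = 4 := by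
    have h := Literature.LinearAlgebra.finrank_biSup_eigenspace_eq_sum A S
    rw [hbiSup, finrank_top, hP4] at h
    exact h.symm
  have hdpos : ∀ c ∈ S, 1 ≤ d c := by
    intro c hc
    rw [Nat.one_le_iff_ne_zero]
    intro h0
    have hbot : A.eigenspace c = ⊥ := Submodule.finrank_eq_zero.1 h0
    apply hEne c hc
    refine LinearMap.ext fun x => ?_
    have hx := hEapply_mem c hc x
    rw [hbot, Submodule.mem_bot] at hx
    rw [hx, LinearMap.zero_apply]
  -- CASE 1: a simple eigenvalue gives a rank-one idempotent in `𝔩`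
  by_cases h1 : ∃ c ∈ S, d c = 1
  · left
    obtain ⟨c, hc, hdc⟩ := h1
    obtain ⟨u, hu, hu0⟩ : ∃ u ∈ A.eigenspace c, u ≠ 0 := by
      have hne : A.eigenspace c ≠ ⊥ := fun h => by
        have : d c = 0 := by
          show Module.finrank ℂ ↥(A.eigenspace c) = 0
          rw [h, finrank_bot]
        omega
      exact (Submodule.ne_bot_iff _).1 hne
    have hdc' : Module.finrank ℂ ↥(A.eigenspace c) = 1 := hdc
    have hline : ∀ w ∈ A.eigenspace c, ∃ r : ℂ, r • u = w := by
      intro w hw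
      have hu0' : (⟨u, hu⟩ : ↥(A.eigenspace c)) ≠ 0 := fun h => hu0 (congrArg Subtype.val h)
      obtain ⟨r, hr⟩ := (finrank_eq_one_iff_of_nonzero' (⟨u, hu⟩ : ↥(A.eigenspace c)) hu0').1 hdc' ⟨w, hw⟩
      exact ⟨r, congrArg Subtype.val hr⟩
    have hπu : E c u = u := by
      obtain ⟨y, hy⟩ : u ∈ LinearMap.range (E c) := by rw [hErange c hc]; exact hu
      rw [← hy, ← Module.End.mul_apply, hEidem c hc]
    obtain ⟨ℓ, hℓ⟩ := Module.Projective.exists_dual_eq_one ℂ hu0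
    set φ : Module.Dual ℂ ↥P := ℓ ∘ₗ E c with hφdef
    have hφu : φ u = 1 := by rw [hφdef, LinearMap.comp_apply, hπu, hℓ]
    have hπeq : φ.smulRight u = E c := by
      refine LinearMap.ext fun x => ?_
      obtain ⟨r, hr⟩ := hline _ (hEapply_mem c hc x)
      rw [LinearMap.smulRight_apply, hφdef, LinearMap.comp_apply, ← hr, map_smul, hℓ, smul_eq_mul, mul_one]
    have he : φ.smulRight u ∈ 𝔩 := by rw [hπeq]; exact hE𝔩 c
    have htop𝔩 := SymplecticThetaSix.eq_top_of_rankOne_idempotent 𝔩 h𝔩br h𝔩1 h𝔩irr hφu he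
    intro A'
    exact (hmem𝔩 A').1 (htop𝔩 ▸ Submodule.mem_top)
  · push Not at h1
    have hd2 : ∀ c ∈ S, 2 ≤ d c := fun c hc => by
      have h := hdpos c hc; have h' := h1 c hc; omega
    have hcard : S.card ≤ 2 := by
      have h := Finset.card_nsmul_le_sum S d 2 hd2
      rw [hdsum, smul_eq_mul] at h
      omega
    have hcard0 : S.card ≠ 0 := by
      intro h0
      rw [Finset.card_eq_zero] at h0
      rw [h0, Finset.sum_empty] at hdsum
      omega
    rcases Nat.lt_or_ge S.card 2 with hlt | hge
    · -- CASE 3: a single eigenvalue, `A = c`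
      right
      have hcard1 : S.card = 1 := by omega
      obtain ⟨c, hSc⟩ := Finset.card_eq_one.1 hcard1
      refine ⟨c, fun p hp => ?_⟩
      have hA1 : A = c • 1 := by
        rw [hSc, Finset.sum_singleton] at hAsum hEsum
        rw [hAsum, hEsum]
      have h := congrArg (fun T : Module.End ℂ ↥P => ((T ⟨p, hp⟩ : ↥P) : M)) hA1
      simpa only [hAapply, LinearMap.smul_apply, Module.End.one_apply, Submodule.coe_smul] using h
    · -- CASE 2: two eigenvalues of multiplicities `(2, 2)`
      left
      have hcard2 : S.card = 2 := le_antisymm hcard hge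
      obtain ⟨a, b, hab, hSab⟩ := Finset.card_eq_two.1 hcard2
      have hsumab : d a + d b = 4 := by rw [hSab, Finset.sum_pair hab] at hdsum; exact hdsum
      have ha : a ∈ S := by rw [hSab]; exact Finset.mem_insert_self _ _
      have hb : b ∈ S := by rw [hSab]; exact Finset.mem_insert_of_mem (Finset.mem_singleton_self _)
      have hda2 := hd2 a ha
      have hdb2 := hd2 b hb
      have hda : d a = 2 := by omega
      have hdb : d b = 2 := by omega
      have hreal' : ∀ c ∈ S, starRingEnd ℂ c = c := fun c hc => hreal c ((Set.Finite.mem_toFinset _).1 hc)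
      have hsumE : E a + E b = 1 := by rw [hSab, Finset.sum_pair hab] at hEsum; exact hEsum
      have hAab : A = a • E a + b • E b := by rw [hSab, Finset.sum_pair hab] at hAsum; exact hAsum
      -- the data of `levi_eq_top_of_twoTwo` for an ordered pair `(x, y)` with `x ≠ 0`
      have key : ∀ x y : ℂ, x ∈ S → y ∈ S → x ≠ y → x ≠ 0 → E x + E y = 1 → A = x • E x + y • E y →
          d x = 2 → ∀ A' : Module.End ℂ ↥P, ∃ Z ∈ spanC 𝔤, ∀ p : ↥P, ((A' p : ↥P) : M) = Z p := by
        intro x y hx hy hxy hx0 hsumxy hAxy hdx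
        have hxx := hEidem x hx
        have hxy0 := hEorth x hx y hy hxy
        have hyx0 := hEorth y hy x hx (Ne.symm hxy)
        have hApt : ∀ p : ↥P, B (C p) = x • ((E x p : ↥P) : M) + y • ((E y p : ↥P) : M) := fun p => by
          rw [← hAapply, hAxy, LinearMap.add_apply, LinearMap.smul_apply, LinearMap.smul_apply, Submodule.coe_add,
            Submodule.coe_smul, Submodule.coe_smul]
        have hrange : Module.finrank ℂ ↥(LinearMap.range (E x)) = 2 := by rw [hErange x hx]; exact hdx
        exact htwoTwo hxy hx0 (hreal' x hx) (hreal' y hy) hsumxy hxx hxy0 hyx0 hApt ((hmem𝔩 _).1 (hE𝔩 x))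
          ((hmem𝔩 _).1 (hE𝔩 y)) hrange
      by_cases ha0 : a = 0
      · have hb0 : b ≠ 0 := fun h => hab (ha0.trans h.symm)
        exact key b a hb ha (Ne.symm hab) hb0 (by rw [add_comm]; exact hsumE) (by rw [add_comm]; exact hAab) hdb
      · exact key a b ha hb hab ha0 hsumE hAab hda

/-- **THE DICHOTOMY IN RANK EIGHT.** Let `H` be an effective polarized weight-one `ℚ`-Hodge structure with
`dim V = 8` and `End_Hdg(V) = ℚ`, and `𝔤 ⊆ End_ℚ(V)` a bracket-closed `ℚ`-subspace of `ψ`-skew operators whose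
complex span contains a Hodge operator `Θ`. Then EITHER every `ψ_ℂ`-skew operator of `V_ℂ` lies in `𝔤_ℂ`
(`𝔤_ℂ = 𝔰𝔭(V,ψ)_ℂ ≅ 𝔰𝔭₈`: «`Hg(X) = Sp(V,φ) ≅ Sp_{8,ℚ}`»), OR `𝔤_ℂ` is in the plus-line position of
`SymplecticThetaTen.plusLine_of_forall_scalar` (raising line `ℂB₀`, lowering line `ℂB̄₀`, `B₀B̄₀ = μ₀ ≠ 0` on
`V^{1,0}`, `B̄₀B₀ = μ₀` on `V^{0,1}` — the complexified shape `𝔰𝔩₂ ⊗ 1 ⊕ 1 ⊗ 𝔨` on `ℂ² ⊗ ℂ⁴` of Mumford's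
examples: «or `Hg(X)` is a `ℚ`-form of an almost direct product of three copies of `SL₂`»).
[cite: MoonenZarhin1999LowDim, Thm. (0.1)(3) and §2 (2.5)(1)] [cite: MoonenZarhin1995Duke, §2 (type I(1))]
[cite: Mumford1969NoteShimura, §4] [cite: Deligne1982HodgeCycles, I §3 Prop. 3.4] -/
theorem SymplecticThetaEight.dichotomy [Module.Finite ℚ V] (H : HodgeStructure V n) (hn : n = 1)
    (heff : H.IsEffective) (ψ : H.Polarization) (hE : ∀ a ∈ H.endAlg, ∃ x : ℚ, a = x • 1)
    (hV : Module.finrank ℚ V = 8) (𝔤 : Submodule ℚ (Module.End ℚ V))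
    (hbr : ∀ X ∈ 𝔤, ∀ X' ∈ 𝔤, X * X' - X' * X ∈ 𝔤) {Θ : Module.End ℂ (ℂ ⊗[ℚ] V)}
    (hΘ : ∀ p, ∀ x ∈ H.piece p (n - p), Θ x = ((2 * p - n : ℤ) : ℂ) • x) (hΘ𝔤 : Θ ∈ spanC 𝔤)
    (hskew : ∀ X ∈ 𝔤, ∀ v w, ψ.form (X v) w + ψ.form v (X w) = 0) :
    (∀ Y : Module.End ℂ (ℂ ⊗[ℚ] V),
        (∀ x y, ψ.form.baseChange ℂ (Y x) y + ψ.form.baseChange ℂ x (Y y) = 0) → Y ∈ spanC 𝔤) ∨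
      ∃ B₀ ∈ spanC 𝔤, ∃ C₀ ∈ spanC 𝔤, ∃ μ₀ : ℂ,
        B₀ ≠ 0 ∧ (∀ p ∈ H.piece 1 0, B₀ p = 0) ∧ (∀ v, B₀ v ∈ H.piece 1 0) ∧
        (∀ v, C₀ v = conj (B₀ (conj v))) ∧ (∀ q ∈ H.piece 0 1, C₀ q = 0) ∧ (∀ v, C₀ v ∈ H.piece 0 1) ∧
        μ₀ ≠ 0 ∧ starRingEnd ℂ μ₀ = μ₀ ∧
        (∀ p ∈ H.piece 1 0, B₀ (C₀ p) = μ₀ • p) ∧ (∀ q ∈ H.piece 0 1, C₀ (B₀ q) = μ₀ • q) ∧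
        (∀ B ∈ spanC 𝔤, (∀ p ∈ H.piece 1 0, B p = 0) → (∀ v, B v ∈ H.piece 1 0) → ∃ c : ℂ, B = c • B₀) ∧
        (∀ C ∈ spanC 𝔤, (∀ q ∈ H.piece 0 1, C q = 0) → (∀ v, C v ∈ H.piece 0 1) → ∃ c : ℂ, C = c • C₀) := by
  have hP4 := (SymplecticThetaEight.finrank_pieces_eq_four H hn heff hV hΘ).1
  have hP0 : H.piece 1 0 ≠ ⊥ := fun h => by rw [h, finrank_bot] at hP4; exact absurd hP4 (by norm_num)
  by_cases hsc : ∀ B ∈ spanC 𝔤, (∀ p ∈ H.piece 1 0, B p = 0) → (∀ v, B v ∈ H.piece 1 0) →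
      ∀ C : Module.End ℂ (ℂ ⊗[ℚ] V), (∀ v, C v = conj (B (conj v))) →
        ∃ μ : ℂ, ∀ p ∈ H.piece 1 0, B (C p) = μ • p
  · exact Or.inr (SymplecticThetaTen.plusLine_of_forall_scalar H hn heff ψ hE 𝔤 hbr hΘ hΘ𝔤 hskew hP0 hsc)
  · left
    push Not at hsc
    obtain ⟨B, hB𝔤, hBP, hBim, C, hC, hnot⟩ := hsc
    rcases SymplecticThetaEight.levi_eq_top_or_scalar H hn heff ψ hE 𝔤 hbr hΘ hΘ𝔤 hskew hP4 hB𝔤 hBP hBim hC with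
      hlevi | ⟨μ, hμ⟩
    · intro Y hY
      exact SymplecticThetaTen.mem_spanC_of_skew_of_levi H hn heff ψ hE 𝔤 hbr hΘ hΘ𝔤 hskew hP0 hlevi hY
    · obtain ⟨p, hp, hne⟩ := hnot μ
      exact absurd (hμ p hp) hne

end Main





end HodgeStructure

end Literature.AlgebraicGeometry.Motives

end
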